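import Literature.NumberTheory.Sieve.MoebiusShiftedPrimesArcs
import Literature.NumberTheory.Sieve.MoebiusShiftedPrimesDecomposition
import Literature.NumberTheory.Sieve.MoebiusShiftedPrimesSieveBound
import HarnessLib

/-!
# Möbius on shifted primes — the major arcs of Lichtman 2020 (Proposition 3.2 from Proposition 3.4)

Topic `Literature/NumberTheory/Sieve`, fifth layer of the decomposition of the named facts
`Literature.NumberTheory.Sieve.lichtman2020_moebius_shifted_primes_avg` / `Literature.NumberTheory.Sieve.lichtman2020_moebius_shifted_primes_avg_power`
(J. D. Lichtman, *Averages of the Möbius function on shifted primes*, Q. J. Math. (2021),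
doi:10.1093/qmath/haab054, arXiv:2009.08969 [Lichtman2020], Theorem 1.1), after
`MoebiusShiftedPrimesProofs.lean` / `MoebiusShiftedPrimesDecomposition.lean` (Thm 1.1 ⇐ Thm 2.2 + (2.5)),
`MoebiusShiftedPrimesSieveBound.lean` ((2.5) proved), `MoebiusShiftedPrimesLiouville.lean`
(Thm 2.2 ⇐ Prop 2.3) and `MoebiusShiftedPrimesArcs.lean` (Prop 2.3 ⇐ Prop 3.1 + Prop 3.2, the two
arcs being NAMED FACTS there).  This file discharges the major-arc fact `Lichtman2020_majorArcEstimate`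
(Proposition 3.2) from the next printed layer, Proposition 3.4.  Page numbers refer to the held copy
`paper:arxiv-2009.08969`.

## Content

* `Lichtman2020_liouvilleMeanSquare` — NAMED FACT: Proposition 3.4 (p. 10), the mean square of
  `λχ𝟙_S` in almost all short intervals `[x, x+h]`, `h ∈ [H/W⁵, H]`, `χ (mod q)`, `q ≤ W`:
  `∫_Y^{2Y} |∑_{x ≤ m ≤ x+h, m ∈ S} λ(m)χ(m)|² dx ≪ h²Y/W¹⁰` (with ONE documented deviation, the
  range of `Y`, see the docstring).
* PROVED: `Lichtman2020_majorArcEstimate_of_liouvilleMeanSquare` (Prop 3.4 ⟹ Prop 3.2, the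
  paper's "Proof of Proposition 3.2 from Proposition 3.4", pp. 10–11), and the composites
  `Lichtman2020_keyFourierEstimate_of_minorArc_of_liouvilleMeanSquare` (Prop 3.1 + Prop 3.4 ⟹
  Thm 2.2), `lichtman2020_moebius_shifted_primes_avg_of_minorArc_of_liouvilleMeanSquare` and
  `lichtman2020_moebius_shifted_primes_avg_power_of_minorArc_of_liouvilleMeanSquare` (⟹ Thm 1.1,
  qualitative and power-range parts; (2.5) is fed by `Lichtman2020_shiftedPrimeSieveBound_holds`).

Hence both renderings of Theorem 1.1 now rest on Proposition 3.1 (minor arcs) and Proposition 3.4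
(mean values of `λχ`; in print ⇐ Proposition 5.1 + Lemmas 4.1, 4.6, 4.8, p. 14).

## The proof (pp. 10–11, discretised)

All integrals are integrals of step functions and are finite sums (`integral_window_div_eq_sum`,
`integral_window_eq_sum_Ioc`).  For `α = a/q + θ ∈ 𝔐(q)`, `q ≤ W`, `|θ| ≤ W⁴/(qH)`:
* (3.9) **Abel summation** in `e(mθ)` on each window `{m : k ≤ md ≤ k+H-1} = {m₀, …, m₀+n}`
  (`norm_sum_Icc_mul_fourierChar_le`): the window sum is at most `P(m₀,n) + |e(θ)-1| ∑_{j<n} P(m₀,j)`,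
  `P(m₀,j) = |∑_{m₀ ≤ m ≤ m₀+j, m ∈ S} λ(m)e(ma/q)|`, `|e(θ) - 1| ≤ 2π|θ|`, and `n ∈ {L-1, L}`,
  `L = ⌊(H-1)/d⌋`;
* `k ↦ m₀ = ⌈k/d⌉` is at most `d`-to-one (`sum_Icc_ceilDiv_le`);
* (3.11)–(3.12) residues `b (mod q)`, `c = (b,q)`, `m = cm'` (`λ(cm') = λ(c)λ(m')`,
  `𝟙_S(cm') = 𝟙_S(m')` as `c ≤ W < P₁, P₂`), orthogonality of the `φ(q/c)` characters mod `q/c`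
  (`DirichletCharacter.sum_char_inv_mul_char_eq`), `#{b : (b,q) = c} = φ(q/c)`
  (`norm_twistedWindow_le_sum_divisors`);
* the divided windows `{m' : n₀ ≤ cm' ≤ n₀+j}` are plain windows of lengths `∈ [H/W⁵, H]`
  (`sum_window_cdiv_le`);
* (3.13) below `X/dW⁵` the trivial bound, above it dyadic blocks `(Y, 2Y]`, Cauchy–Schwarz and
  Proposition 3.4 (`sum_Icc_le_of_dyadic`, `sum_plainWindow_le`, `sum_twistedWindow_le`);
* (3.10)–(3.11) numerics (`majorArc_numerics`): the total is `≤ (2C₁ + 2πC₁ + 8π) HX/(dW)`,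
  `C₁ = 6 + 12√C`, `C` the constant of Proposition 3.4 (`majorArc_fixed_bound`).

## Faithfulness notes

* Proposition 3.4 is rendered like the facts of the previous layers (`X : ℕ`, `H : ℕ → ℕ`, the
  typical set without the cut-off `m ≤ X/d`, "`≪`" as `∃ C, ∀ᶠ X, ∀ …`), with the deviation in the
  range of `Y` explained at the fact: the printed range `[X/W⁴, X]` is not what the printed
  deduction of Proposition 3.2 uses (it needs `Y ≥ X/2dW⁵`), and the printed proof of
  Proposition 3.4 gives every `Y ∈ [X^{1/2}, X]`; we record `[X/W⁶, X]`.
* In (3.9) the paper bounds the boundary term by `I_{H/d}`; discretely the full windows have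
  `⌊(H-1)/d⌋` or `⌊(H-1)/d⌋ + 1` elements, whence the two terms `I'(L-1) + I'(L)`.

## Source

* J. D. Lichtman, *Averages of the Möbius function on shifted primes*, arXiv:2009.08969, §3.2:
  Proposition 3.4 and "Proof of Proposition 3.2 from Proposition 3.4", (3.8)–(3.13), pp. 10–11;
  §5, p. 14 (proof of Proposition 3.4, for the range of `Y`).
-/

namespace Literature.NumberTheory.Sieve

open Filter Asymptotics Finset MeasureTheory
open scoped FourierTransform Topology

/-! ### Proposition 3.4 (named fact) -/

/-- NAMED FACT — **Lichtman 2020, Proposition 3.4 (mean value of `λχ` on the typical set in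
almost all short intervals)**, as printed (p. 10): "Given `A > 5`, `δ > 0`, let `q ≤ W = (log X)^A`,
`d < W³³`, `χ (mod q)`, `h ∈ [H/W⁵, H]`, and `S_d = S_d(X,A,δ)` as in (2.8). Then for all
`Y ∈ [X/W⁴, X]`, we have
`J_{d,h,q}(Y;χ) := ∫_Y^{2Y} |(1/h) ∑_{x ≤ m ≤ x+h, m ∈ S_d} λ(m)χ(m)|² dx ≪_{A,δ} Y/W¹⁰`."
Rendering, as for Theorem 2.2 / Proposition 2.3 (`Lichtman2020_keyFourierEstimate`,
`Lichtman2020_keyFourierEstimateLiouville'`): `X : ℕ`; `H : ℕ → ℕ` under the standing assumptions of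
§3, "`H = (log X)^{ψ(X)}`, `ψ(X) → ∞`" and "`H ≤ exp((log X)^{2/3})` hereafter" (p. 8; as hypotheses
they only weaken the fact); `h : ℕ`; the integers of `[x, x+h]` are `Icc ⌈x⌉₊ ⌊x+h⌋₊`; `m ∈ S_d` is
the typical-factorisation predicate `lichtmanTypical X A δ H m` — the cut-off `m ≤ X/d` of (2.8), the
only place where `d` enters, is omitted as in the two facts above, so `d` disappears; the factor
`(1/h)²` is moved to the right; "`≪_{A,δ}`" (uniform in `q, χ, h, Y`) is `∃ C, ∀ᶠ X, ∀ q χ h Y`, the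
constant being chosen after `H` (weaker than the print).
ONE DOCUMENTED DEVIATION — the range of `Y`.  Printed: `Y ∈ [X/W⁴, X]`; recorded: `Y ∈ [X/W⁶, X]`.
The printed deduction of Proposition 3.2 (p. 10: "We may discard the contribution … of the
integral over `y ≤ X/dW⁵`", then (3.13): dyadic `Y` with "`X/(2dW⁵) ≤ Y`") applies Proposition 3.4
below `X/W⁴` (down to `X/2dW⁵ ≥ X/2W⁶`), so the printed range does not suffice for the printed
proof of Proposition 3.2, while the printed proof of Proposition 3.4 (p. 14: Lemma 4.8, the
Parseval bound Lemma 4.6 with `T₀ = (log X)^{2B}`, Proposition 5.1 for `Y ∈ [X^{1/2}, X²]`, and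
`Y/(h₁X) ≤ W⁵/H`) is verbatim for every `Y ∈ [X^{1/2}, X]`.  We record the range `[X/W⁶, X]` that
the deduction `Lichtman2020_majorArcEstimate_of_liouvilleMeanSquare` below consumes.
Users take `(h : Lichtman2020_liouvilleMeanSquare)`. [cite: Lichtman2020, Proposition 3.4] -/
def Lichtman2020_liouvilleMeanSquare : Prop :=
  ∀ A : ℝ, 5 < A → ∀ δ : ℝ, 0 < δ → ∀ H : ℕ → ℕ,
    Tendsto (fun X : ℕ => Real.log (H X) / Real.log (Real.log X)) atTop atTop →
    (∀ᶠ X : ℕ in atTop, (H X : ℝ) ≤ Real.exp (Real.log X ^ (2 / 3 : ℝ))) →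
    ∃ C : ℝ, ∀ᶠ X : ℕ in atTop, ∀ q : ℕ, 1 ≤ q → (q : ℝ) ≤ Real.log X ^ A →
      ∀ χ : DirichletCharacter ℂ q, ∀ h : ℕ,
        (H X : ℝ) / Real.log X ^ (5 * A) ≤ h → h ≤ H X →
        ∀ Y : ℝ, (X : ℝ) / Real.log X ^ (6 * A) ≤ Y → Y ≤ X →
          ∫ x in Y..2 * Y,
              ‖∑ m ∈ (Icc ⌈x⌉₊ ⌊x + h⌋₊).filter (lichtmanTypical X A δ (H X)),
                  ((ArithmeticFunction.liouville m : ℤ) : ℂ) * χ (m : ZMod q)‖ ^ 2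
            ≤ C * ((h : ℝ) ^ 2 * Y / Real.log X ^ (10 * A))

namespace Lichtman2020

/-! ### Elementary tools: `e(θ) - 1`, Abel summation, periodicity -/

/-- `|e(θ) - 1| ≤ 2π|θ|`. [folklore] -/
theorem norm_fourierChar_sub_one_le (θ : ℝ) :
    ‖(𝐞 θ : ℂ) - 1‖ ≤ 2 * Real.pi * |θ| := by
  rw [Real.fourierChar_apply, mul_comm _ Complex.I]
  refine (Real.norm_exp_I_mul_ofReal_sub_one_le).trans (le_of_eq ?_)
  rw [Real.norm_eq_abs, abs_mul, abs_of_pos Real.two_pi_pos]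

/-- `e((m+1)θ) - e(mθ) = e(mθ)(e(θ) - 1)`. [folklore] -/
theorem fourierChar_succ_mul_sub (m : ℕ) (θ : ℝ) :
    (𝐞 (((m + 1 : ℕ) : ℝ) * θ) : ℂ) - 𝐞 ((m : ℝ) * θ) = 𝐞 ((m : ℝ) * θ) * ((𝐞 θ : ℂ) - 1) := by
  have : ((m + 1 : ℕ) : ℝ) * θ = (m : ℝ) * θ + θ := by push_cast; ring
  rw [this, AddChar.map_add_eq_mul, Circle.coe_mul]
  ring

/-- **Abel summation identity** on a window `{m₀, …, m₀ + n}`: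
`∑ f(m) e(mθ) = e((m₀+n)θ) F(n) - (e(θ) - 1) ∑_{j<n} e((m₀+j)θ) F(j)`, `F(j) = ∑_{m₀ ≤ m ≤ m₀+j} f(m)`.
[folklore] -/
theorem sum_Icc_mul_fourierChar_eq (f : ℕ → ℂ) (θ : ℝ) (m₀ : ℕ) (n : ℕ) :
    ∑ m ∈ Icc m₀ (m₀ + n), f m * (𝐞 ((m : ℝ) * θ) : ℂ) =
      (𝐞 (((m₀ + n : ℕ) : ℝ) * θ) : ℂ) * ∑ m ∈ Icc m₀ (m₀ + n), f m -
        ((𝐞 θ : ℂ) - 1) * ∑ j ∈ range n,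
          (𝐞 (((m₀ + j : ℕ) : ℝ) * θ) : ℂ) * ∑ m ∈ Icc m₀ (m₀ + j), f m := by
  induction n with
  | zero => simp [mul_comm]
  | succ n ih =>
    rw [show m₀ + (n + 1) = m₀ + n + 1 by ring, Finset.sum_Icc_succ_top (by omega), ih,
      Finset.sum_Icc_succ_top (by omega), Finset.sum_range_succ]
    have h := fourierChar_succ_mul_sub (m₀ + n) θ
    rw [show m₀ + n + 1 = m₀ + n + 1 from rfl] at h
    -- abbreviate
    set E1 : ℂ := (𝐞 (((m₀ + n + 1 : ℕ) : ℝ) * θ) : ℂ)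
    set E0 : ℂ := (𝐞 (((m₀ + n : ℕ) : ℝ) * θ) : ℂ)
    set F : ℂ := ∑ m ∈ Icc m₀ (m₀ + n), f m
    set ε : ℂ := (𝐞 θ : ℂ) - 1
    have hE1 : E1 = E0 + E0 * ε := by rw [← h]; ring
    rw [hE1]
    ring

/-- **Abel summation bound**: `|∑_{m₀ ≤ m ≤ m₀+n} f(m) e(mθ)| ≤ |F(n)| + |e(θ) - 1| ∑_{j<n} |F(j)|`.
[folklore] -/
theorem norm_sum_Icc_mul_fourierChar_le (f : ℕ → ℂ) (θ : ℝ) (m₀ : ℕ) (n : ℕ) :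
    ‖∑ m ∈ Icc m₀ (m₀ + n), f m * (𝐞 ((m : ℝ) * θ) : ℂ)‖ ≤
      ‖∑ m ∈ Icc m₀ (m₀ + n), f m‖ +
        ‖(𝐞 θ : ℂ) - 1‖ * ∑ j ∈ range n, ‖∑ m ∈ Icc m₀ (m₀ + j), f m‖ := by
  rw [sum_Icc_mul_fourierChar_eq]
  refine (norm_sub_le _ _).trans (add_le_add ?_ ?_)
  · rw [norm_mul, norm_fourierChar, one_mul]
  · rw [norm_mul]
    refine mul_le_mul_of_nonneg_left ((norm_sum_le _ _).trans (le_of_eq ?_)) (norm_nonneg _)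
    refine Finset.sum_congr rfl fun j _ => ?_
    rw [norm_mul, norm_fourierChar, one_mul]

/-- Periodicity: `e(ma/q)` only depends on `m mod q`. [folklore] -/
theorem fourierChar_natCast_mul_div_of_mod_eq {q m b : ℕ} (a : ℤ) (h : m % q = b % q) :
    (𝐞 ((m : ℝ) * (a / q)) : ℂ) = 𝐞 ((b : ℝ) * (a / q)) := by
  rcases Nat.eq_zero_or_pos q with rfl | hq
  · simp
  have hmod : (b : ℤ) ≡ (m : ℤ) [ZMOD (q : ℤ)] := by
    have := (Nat.modEq_iff_dvd.mp (show b ≡ m [MOD q] from h.symm))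
    exact (Int.modEq_iff_dvd.mpr this)
  obtain ⟨t, ht⟩ := (Int.modEq_iff_dvd.mp hmod)
  -- `m - b = q t`
  have hq0 : (q : ℝ) ≠ 0 := by exact_mod_cast hq.ne'
  have key : (m : ℝ) * (a / q) = (b : ℝ) * (a / q) + ((t * a : ℤ) : ℝ) := by
    have h1 : ((m : ℤ) : ℝ) - ((b : ℤ) : ℝ) = ((q : ℤ) : ℝ) * (t : ℝ) := by exact_mod_cast ht
    push_cast at h1 ⊢
    field_simp
    linear_combination (a : ℝ) * h1
  rw [key, AddChar.map_add_eq_mul, Circle.coe_mul, Literature.NumberTheory.Sieve.RamanujanSum.fourierChar_intCast, mul_one]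

/-- Splitting a sum over residues: `∑_{m ∈ T} g(m) = ∑_{b mod q} ∑_{m ∈ T, m ≡ b} g(m)` (`q ≥ 1`).
[folklore] -/
theorem sum_eq_sum_range_mod {M : Type*} [AddCommMonoid M] {q : ℕ} (hq : 0 < q) (T : Finset ℕ)
    (g : ℕ → M) : ∑ m ∈ T, g m = ∑ b ∈ range q, ∑ m ∈ T with m % q = b, g m :=
  (Finset.sum_fiberwise_of_maps_to (fun m _ => Finset.mem_range.mpr (Nat.mod_lt m hq)) g).symm

/-- The twisted window sum split into residue classes:
`|∑_{m ∈ T} c(m) e(ma/q)| ≤ ∑_{b mod q} |∑_{m ∈ T, m ≡ b (q)} c(m)|`. [folklore] -/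
theorem norm_sum_mul_fourierChar_div_le {q : ℕ} (hq : 0 < q) (T : Finset ℕ) (c : ℕ → ℂ) (a : ℤ) :
    ‖∑ m ∈ T, c m * (𝐞 ((m : ℝ) * (a / q)) : ℂ)‖ ≤
      ∑ b ∈ range q, ‖∑ m ∈ T with m % q = b, c m‖ := by
  rw [sum_eq_sum_range_mod hq T]
  refine (norm_sum_le _ _).trans (Finset.sum_le_sum fun b hb => ?_)
  have hb' : b % q = b := Nat.mod_eq_of_lt (Finset.mem_range.mp hb)
  have : ∑ m ∈ T with m % q = b, c m * (𝐞 ((m : ℝ) * (a / q)) : ℂ) =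
      (∑ m ∈ T with m % q = b, c m) * (𝐞 ((b : ℝ) * (a / q)) : ℂ) := by
    rw [Finset.sum_mul]
    refine Finset.sum_congr rfl fun m hm => ?_
    have hmb : m % q = b % q := by rw [(Finset.mem_filter.mp hm).2, hb']
    rw [fourierChar_natCast_mul_div_of_mod_eq a hmb]
  rw [this, norm_mul, norm_fourierChar, mul_one]

/-! ### Orthogonality of Dirichlet characters on a residue class -/

/-- Detecting a reduced residue class with characters:
`∑_{m ∈ T, m ≡ b (q)} f(m) = φ(q)⁻¹ ∑_χ χ(b)⁻¹ ∑_{m ∈ T} χ(m) f(m)` for `(b, q) = 1`. [folklore] -/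
theorem sum_filter_mod_eq_sum_char {q : ℕ} [NeZero q] {b : ℕ} (hb : b.Coprime q) (T : Finset ℕ)
    (f : ℕ → ℂ) :
    ∑ m ∈ T with m % q = b % q, f m =
      ((q.totient : ℂ))⁻¹ * ∑ χ : DirichletCharacter ℂ q,
        χ ((b : ZMod q))⁻¹ * ∑ m ∈ T, χ (m : ZMod q) * f m := by
  have hu : IsUnit ((b : ℕ) : ZMod q) := (ZMod.isUnit_iff_coprime b q).2 hb
  have hφ : (q.totient : ℂ) ≠ 0 := by
    exact_mod_cast (Nat.totient_pos.mpr (NeZero.pos q)).ne'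
  calc ∑ m ∈ T with m % q = b % q, f m
      = ∑ m ∈ T, (if ((b : ℕ) : ZMod q) = (m : ZMod q) then f m else 0) := by
        rw [Finset.sum_filter]
        refine Finset.sum_congr rfl fun m _ => ?_
        have : ((b : ℕ) : ZMod q) = (m : ZMod q) ↔ m % q = b % q := by
          rw [ZMod.natCast_eq_natCast_iff']; exact eq_comm
        simp only [this]
    _ = ∑ m ∈ T, ((q.totient : ℂ))⁻¹ *
          ((∑ χ : DirichletCharacter ℂ q, χ ((b : ZMod q))⁻¹ * χ (m : ZMod q)) * f m) := by
        refine Finset.sum_congr rfl fun m _ => ?_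
        rw [DirichletCharacter.sum_char_inv_mul_char_eq ℂ hu]
        split_ifs
        · field_simp
        · simp
    _ = _ := by
        rw [← Finset.mul_sum]
        congr 1
        simp_rw [Finset.sum_mul, Finset.mul_sum, mul_assoc]
        exact Finset.sum_comm

/-- The norm form: `|∑_{m ∈ T, m ≡ b (q)} f(m)| ≤ φ(q)⁻¹ ∑_χ |∑_{m ∈ T} χ(m) f(m)|` for
`(b, q) = 1`. [folklore] -/
theorem norm_sum_filter_mod_le_sum_char {q : ℕ} [NeZero q] {b : ℕ} (hb : b.Coprime q)
    (T : Finset ℕ) (f : ℕ → ℂ) :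
    ‖∑ m ∈ T with m % q = b % q, f m‖ ≤
      ((q.totient : ℝ))⁻¹ * ∑ χ : DirichletCharacter ℂ q, ‖∑ m ∈ T, χ (m : ZMod q) * f m‖ := by
  rw [sum_filter_mod_eq_sum_char hb, norm_mul, norm_inv, Complex.norm_natCast]
  refine mul_le_mul_of_nonneg_left ((norm_sum_le _ _).trans (Finset.sum_le_sum fun χ _ => ?_))
    (by positivity)
  rw [norm_mul]
  refine (mul_le_mul_of_nonneg_right (DirichletCharacter.norm_le_one χ _) (norm_nonneg _)).trans ?_
  rw [one_mul]

/-- Grouping residues by their gcd with the modulus: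
`∑_{b mod q} g((b,q)) = ∑_{c ∣ q} φ(q/c) g(c)` (`q ≥ 1`). [folklore] -/
theorem sum_range_gcd_eq_sum_divisors {q : ℕ} (hq : q ≠ 0) (g : ℕ → ℝ) :
    ∑ b ∈ range q, g (q.gcd b) = ∑ c ∈ q.divisors, ((q / c).totient : ℝ) * g c := by
  rw [← Finset.sum_fiberwise_of_maps_to' (g := fun b => q.gcd b) (t := q.divisors)
    (fun b _ => Nat.mem_divisors.mpr ⟨Nat.gcd_dvd_left q b, hq⟩)]
  refine Finset.sum_congr rfl fun c hc => ?_
  rw [Finset.sum_const, nsmul_eq_mul, Nat.totient_div_of_dvd (Nat.dvd_of_mem_divisors hc)]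

/-- `∑_{c ∣ q} φ(q/c) = q`. [folklore] -/
theorem sum_divisors_totient_div {q : ℕ} : ∑ c ∈ q.divisors, ((q / c).totient : ℝ) = q := by
  have h := Nat.sum_div_divisors q Nat.totient
  rw [Nat.sum_totient] at h
  exact_mod_cast h

/-! ### Windows, divided windows and the extraction of the gcd -/

open ArithmeticFunction in
/-- `|λ(m)| ≤ 1` in `ℂ`. [folklore] -/
theorem norm_liouville_le_one (m : ℕ) : ‖((liouville m : ℤ) : ℂ)‖ ≤ 1 := by
  rw [Complex.norm_intCast]
  exact_mod_cast abs_liouville_le_one m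

/-- The integers `m` with `u ≤ cm ≤ v` are those of `Icc ⌈u/c⌉ ⌊v/c⌋ = Icc ((u+c-1)/c) (v/c)` (`c ≥ 1`).
[folklore] -/
theorem mem_Icc_cdiv_iff {c u v m : ℕ} (hc : 0 < c) :
    m ∈ Icc ((u + c - 1) / c) (v / c) ↔ u ≤ c * m ∧ c * m ≤ v := by
  rw [Finset.mem_Icc, Nat.div_le_iff_le_mul_add_pred hc, Nat.le_div_iff_mul_le hc, mul_comm m c]
  omega

/-- The divided window of `MoebiusShiftedPrimesLiouville` in closed form:
`windowDiv e H k = Icc ⌈k/e⌉ ⌊(k+H-1)/e⌋` (`e, k ≥ 1`). [folklore] -/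
theorem windowDiv_eq_Icc {e H k : ℕ} (he : 0 < e) (hk : 1 ≤ k) :
    windowDiv e H k = Icc ((k + e - 1) / e) ((k + H - 1) / e) := by
  ext m
  rw [mem_windowDiv hk, mem_Icc_cdiv_iff he, mul_comm e m]

open ArithmeticFunction in
/-- **Extraction of the gcd** (p. 10: "Let `c := (b,q)` so that `c ∣ n`, and we let `b' = b/c`,
`q' = q/c`, `m = n/c`"): for `q = cq'`, `b = cb'` (`b' < q'`) and a set `S` with `cm ∈ S ↔ m ∈ S`,
`∑_{u ≤ n ≤ v, n ∈ S, n ≡ b (q)} λ(n) = λ(c) ∑_{u ≤ cm ≤ v, m ∈ S, m ≡ b' (q')} λ(m)`.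
[cite: Lichtman2020, §3.2, p. 10] -/
theorem sum_residue_eq_liouville_mul {q b c q' b' : ℕ} (hc : 0 < c) (hq : q = c * q')
    (hbq : b = c * b') (hb' : b' < q') (S : ℕ → Prop) [DecidablePred S]
    (hS : ∀ m, S (c * m) ↔ S m) (u v : ℕ) :
    ∑ n ∈ (Icc u v).filter S with n % q = b, ((liouville n : ℤ) : ℂ) =
      ((liouville c : ℤ) : ℂ) *
        ∑ m ∈ (Icc ((u + c - 1) / c) (v / c)).filter S with m % q' = b', ((liouville m : ℤ) : ℂ) := by
  have hq' : 0 < q' := by omega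
  have hbq_lt : b < q := by rw [hq, hbq]; exact Nat.mul_lt_mul_of_pos_left hb' hc
  rw [Finset.mul_sum]
  symm
  refine Finset.sum_nbij' (fun m => c * m) (fun n => n / c) ?_ ?_ ?_ ?_ ?_
  · intro m hm
    simp only [Finset.mem_filter] at hm ⊢
    rw [mem_Icc_cdiv_iff hc] at hm
    refine ⟨⟨Finset.mem_Icc.mpr hm.1.1, (hS m).mpr hm.1.2⟩, ?_⟩
    -- `c m = q (m / q') + b`
    have h1 : m = q' * (m / q') + b' := by rw [← hm.2]; exact (Nat.div_add_mod m q').symm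
    have h2 : c * m = (m / q') * q + b := by
      rw [hq, hbq]
      nth_rewrite 1 [h1]
      ring
    rw [h2, Nat.mul_add_mod', Nat.mod_eq_of_lt hbq_lt]
  · intro n hn
    simp only [Finset.mem_filter] at hn ⊢
    have hIcc := Finset.mem_Icc.mp hn.1.1
    -- `n = q (n/q) + b = c (q' (n/q) + b')`
    have h1 : n = c * (q' * (n / q) + b') := by
      have := (Nat.div_add_mod n q).symm
      rw [hn.2] at this
      nth_rewrite 1 [this]
      rw [hq, hbq]; ring
    have h2 : n / c = q' * (n / q) + b' := by
      nth_rewrite 1 [h1]; exact Nat.mul_div_cancel_left _ hc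
    have h3 : c * (n / c) = n := by rw [h2, ← h1]
    refine ⟨⟨(mem_Icc_cdiv_iff hc).mpr ?_, ?_⟩, ?_⟩
    · rw [h3]; exact hIcc
    · rw [← hS, h3]; exact hn.1.2
    · rw [h2, Nat.mul_add_mod, Nat.mod_eq_of_lt hb']
  · intro m _
    exact Nat.mul_div_cancel_left m hc
  · intro n hn
    simp only [Finset.mem_filter] at hn
    -- `c ∣ n`
    have h1 : n = c * (q' * (n / q) + b') := by
      have := (Nat.div_add_mod n q).symm
      rw [hn.2] at this
      nth_rewrite 1 [this]
      rw [hq, hbq]; ring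
    nth_rewrite 1 [h1]
    rw [Nat.mul_div_cancel_left _ hc, ← h1]
  · intro m _
    push_cast [liouville_apply_mul]
    ring

open ArithmeticFunction in
/-- **Residue classes, gcd extraction and orthogonality** (p. 10, (3.11)–(3.12)): for `q ≥ 1`,
`a ∈ ℤ` and a set `S` invariant under multiplication by the divisors of `q`,
`|∑_{u ≤ n ≤ v, n ∈ S} λ(n) e(na/q)| ≤ ∑_{c ∣ q} ∑_{χ (mod q/c)} |∑_{u ≤ cm ≤ v, m ∈ S} λ(m)χ(m)|`.
[cite: Lichtman2020, §3.2, (3.12)] -/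
theorem norm_twistedWindow_le_sum_divisors {q : ℕ} (hq : 0 < q) (a : ℤ) (S : ℕ → Prop)
    [DecidablePred S] (hS : ∀ c ∈ q.divisors, ∀ m, S (c * m) ↔ S m) (u v : ℕ) :
    ‖∑ n ∈ (Icc u v).filter S, ((liouville n : ℤ) : ℂ) * (𝐞 ((n : ℝ) * (a / q)) : ℂ)‖ ≤
      ∑ c ∈ q.divisors, ∑ χ : DirichletCharacter ℂ (q / c),
        ‖∑ m ∈ (Icc ((u + c - 1) / c) (v / c)).filter S,
            χ (m : ZMod (q / c)) * ((liouville m : ℤ) : ℂ)‖ := by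
  -- the bound attached to a divisor `c`
  set g : ℕ → ℝ := fun c => (((q / c).totient : ℝ))⁻¹ * ∑ χ : DirichletCharacter ℂ (q / c),
      ‖∑ m ∈ (Icc ((u + c - 1) / c) (v / c)).filter S,
          χ (m : ZMod (q / c)) * ((liouville m : ℤ) : ℂ)‖ with hg
  -- step 1: residue classes
  refine (norm_sum_mul_fourierChar_div_le hq _ _ a).trans ?_
  -- step 2: each residue class `b` is bounded by `g (q.gcd b)`
  have hstep : ∀ b ∈ range q,
      ‖∑ n ∈ (Icc u v).filter S with n % q = b, ((liouville n : ℤ) : ℂ)‖ ≤ g (q.gcd b) := by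
    intro b hb
    rw [Finset.mem_range] at hb
    set c := q.gcd b with hc
    have hc0 : 0 < c := Nat.gcd_pos_of_pos_left b hq
    have hcq : c ∣ q := Nat.gcd_dvd_left q b
    have hcb : c ∣ b := Nat.gcd_dvd_right q b
    have hq' : q = c * (q / c) := (Nat.mul_div_cancel' hcq).symm
    have hb' : b = c * (b / c) := (Nat.mul_div_cancel' hcb).symm
    have hlt : b / c < q / c := Nat.div_lt_div_of_lt_of_dvd hcq hb
    have hq'0 : 0 < q / c := Nat.div_pos (Nat.le_of_dvd hq hcq) hc0
    haveI : NeZero (q / c) := ⟨hq'0.ne'⟩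
    have hcop : (b / c).Coprime (q / c) := (Nat.coprime_div_gcd_div_gcd (m := q) (n := b) hc0).symm
    rw [sum_residue_eq_liouville_mul hc0 hq' hb' hlt S (hS c (Nat.mem_divisors.mpr ⟨hcq, hq.ne'⟩)),
      norm_mul]
    refine (mul_le_of_le_one_left (norm_nonneg _) (norm_liouville_le_one c)).trans ?_
    have hmod : b / c = (b / c) % (q / c) := (Nat.mod_eq_of_lt hlt).symm
    have h := norm_sum_filter_mod_le_sum_char hcop
      ((Icc ((u + c - 1) / c) (v / c)).filter S) (fun m => ((liouville m : ℤ) : ℂ))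
    rw [← hmod] at h
    exact h
  refine (Finset.sum_le_sum hstep).trans ?_
  -- step 3: group by the gcd
  rw [sum_range_gcd_eq_sum_divisors hq.ne' g]
  refine Finset.sum_le_sum fun c hc => le_of_eq ?_
  have hcq := Nat.dvd_of_mem_divisors hc
  have hq'0 : 0 < q / c := Nat.div_pos (Nat.le_of_dvd hq hcq) (Nat.pos_of_mem_divisors hc)
  have hφ : ((q / c).totient : ℝ) ≠ 0 := by exact_mod_cast (Nat.totient_pos.mpr hq'0).ne'
  rw [hg]
  simp only
  rw [← mul_assoc, mul_inv_cancel₀ hφ, one_mul]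

/-! ### Re-indexing sums of window functionals -/

/-- **From `k ≤ X` to `n₀ = ⌈k/d⌉ ≤ ⌈X/d⌉`**: each value of `⌈k/d⌉` is taken at most `d` times, so
`∑_{k=1}^{X} P(⌈k/d⌉) ≤ d ∑_{n₀=1}^{⌈X/d⌉} P(n₀)` for `P ≥ 0`. [folklore] -/
theorem sum_Icc_ceilDiv_le {d : ℕ} (hd : 0 < d) (X : ℕ) (P : ℕ → ℝ) (hP : ∀ n, 0 ≤ P n) :
    ∑ k ∈ Icc 1 X, P ((k + d - 1) / d) ≤ (d : ℝ) * ∑ n ∈ Icc 1 ((X + d - 1) / d), P n := by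
  have hmaps : ∀ k ∈ Icc 1 X, (k + d - 1) / d ∈ Icc 1 ((X + d - 1) / d) := by
    intro k hk
    rw [Finset.mem_Icc] at hk ⊢
    constructor
    · exact (Nat.le_div_iff_mul_le hd).mpr (by omega)
    · exact Nat.div_le_div_right (by omega)
  rw [← Finset.sum_fiberwise_of_maps_to' hmaps, Finset.mul_sum]
  refine Finset.sum_le_sum fun n hn => ?_
  rw [Finset.sum_const, nsmul_eq_mul]
  refine mul_le_mul_of_nonneg_right ?_ (hP n)
  -- the fibre lies in `Icc (nd - d + 1) (nd)`
  have hsub : (Icc 1 X).filter (fun k => (k + d - 1) / d = n) ⊆ Icc (n * d - d + 1) (n * d) := by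
    intro k hk
    rw [Finset.mem_filter] at hk
    have h1 : n * d ≤ k + d - 1 := (Nat.le_div_iff_mul_le hd).mp hk.2.ge
    have h2 : k + d - 1 ≤ d * n + (d - 1) := (Nat.div_le_iff_le_mul_add_pred hd).mp hk.2.le
    have hk1 := (Finset.mem_Icc.mp hk.1).1
    rw [Finset.mem_Icc]
    rw [mul_comm] at h2
    generalize n * d = M at h1 h2 ⊢
    constructor <;> omega
  calc (#((Icc 1 X).filter (fun k => (k + d - 1) / d = n)) : ℝ)
      ≤ #(Icc (n * d - d + 1) (n * d)) := by exact_mod_cast Finset.card_le_card hsub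
    _ ≤ d := by
        rw [Nat.card_Icc]
        exact_mod_cast (by omega : n * d + 1 - (n * d - d + 1) ≤ d)

/-- **From divided windows to plain windows** (the substitution `y = x/cd` of p. 10): for `c ≥ 1`
and a functional `G ≥ 0` of finite sets with `G(∅) = 0`, the windows `{m : n ≤ cm ≤ n + j}`,
`1 ≤ n ≤ N`, are plain windows `{m₀, …, m₀ + ℓ_r}` (`r = n mod c`,
`ℓ_r = ⌊(r+j)/c⌋ - 𝟙[r ≠ 0]`, `m₀ = ⌈n/c⌉ ≤ ⌊(N-1)/c⌋ + 1`), each pair `(r, m₀)` occurring once.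
[folklore] -/
theorem sum_window_cdiv_le {c : ℕ} (hc : 0 < c) (N j : ℕ) (G : Finset ℕ → ℝ)
    (hG0 : ∀ s, 0 ≤ G s) (hGe : G ∅ = 0) :
    ∑ n ∈ Icc 1 N, G (Icc ((n + c - 1) / c) ((n + j) / c)) ≤
      ∑ r ∈ range c, ∑ m ∈ Icc 1 ((N - 1) / c + 1),
        G (Icc m (m + ((r + j) / c - if r = 0 then 0 else 1))) := by
  classical
  rw [sum_eq_sum_range_mod hc (Icc 1 N)]
  refine Finset.sum_le_sum fun r hr => ?_
  rw [Finset.mem_range] at hr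
  set ℓ : ℕ := (r + j) / c - if r = 0 then 0 else 1 with hℓ
  set ψ : ℕ → ℕ := fun n => (n + c - 1) / c with hψ
  -- arithmetic of `n = c t + r`
  have hdecomp : ∀ n : ℕ, n % c = r →
      (n + c - 1) / c = n / c + (if r = 0 then 0 else 1) ∧ (n + j) / c = n / c + (r + j) / c := by
    intro n hn
    have h0 : n = r + c * (n / c) := by
      have := Nat.mod_add_div n c
      rw [hn] at this
      exact this.symm
    constructor
    · have h1 : n + c - 1 = (r + c - 1) + c * (n / c) := by omega
      rw [h1, Nat.add_mul_div_left _ _ hc]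
      have h2 : (r + c - 1) / c = if r = 0 then 0 else 1 := by
        split_ifs with h
        · subst h
          exact Nat.div_eq_of_lt (by omega)
        · exact Nat.div_eq_of_lt_le (by omega) (by omega)
      rw [h2]; ring
    · have h1 : n + j = (r + j) + c * (n / c) := by omega
      rw [h1, Nat.add_mul_div_left _ _ hc]; ring
  -- pointwise comparison of the windows
  have hpt : ∀ n ∈ (Icc 1 N).filter (fun n => n % c = r),
      G (Icc ((n + c - 1) / c) ((n + j) / c)) ≤ G (Icc (ψ n) (ψ n + ℓ)) := by
    intro n hn
    rw [Finset.mem_filter] at hn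
    obtain ⟨h1, h2⟩ := hdecomp n hn.2
    simp only [hψ]
    rw [h1, h2, hℓ]
    by_cases hr0 : r = 0
    · simp [hr0]
    · simp only [hr0, if_false]
      by_cases hj : 1 ≤ (r + j) / c
      · have : n / c + 1 + ((r + j) / c - 1) = n / c + (r + j) / c := by omega
        rw [this]
      · have hempty : Icc (n / c + 1) (n / c + (r + j) / c) = ∅ := by
          rw [Finset.Icc_eq_empty]; omega
        rw [hempty, hGe]
        exact hG0 _
  refine (Finset.sum_le_sum hpt).trans ?_
  -- `ψ` is injective on the residue class and maps into `Icc 1 ((N-1)/c + 1)`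
  have hinj : Set.InjOn ψ ↑((Icc 1 N).filter (fun n => n % c = r)) := by
    intro n₁ hn₁ n₂ hn₂ h
    simp only [Finset.coe_filter, Set.mem_setOf_eq] at hn₁ hn₂
    simp only [hψ] at h
    rw [(hdecomp n₁ hn₁.2).1, (hdecomp n₂ hn₂.2).1] at h
    have h' : n₁ / c = n₂ / c := by omega
    have e1 := Nat.mod_add_div n₁ c
    have e2 := Nat.mod_add_div n₂ c
    rw [hn₁.2] at e1; rw [hn₂.2] at e2
    rw [← e1, ← e2, h']
  rw [← Finset.sum_image (f := fun m => G (Icc m (m + ℓ))) hinj]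
  refine Finset.sum_le_sum_of_subset_of_nonneg ?_ (fun _ _ _ => hG0 _)
  intro m hm
  rw [Finset.mem_image] at hm
  obtain ⟨n, hn, rfl⟩ := hm
  rw [Finset.mem_filter, Finset.mem_Icc] at hn
  simp only [hψ]
  rw [Finset.mem_Icc]
  constructor
  · exact (Nat.le_div_iff_mul_le hc).mpr (by omega)
  · have : n + c - 1 = (n - 1) + c := by omega
    rw [this, Nat.add_div_right _ hc]
    exact Nat.add_le_add_right (Nat.div_le_div_right (by omega)) 1

/-! ### Dyadic decomposition and Cauchy–Schwarz -/

/-- **Cauchy–Schwarz on a dyadic block**: `∑_{Y < m ≤ 2Y} Q(m) ≤ √K · Y` if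
`∑_{Y < m ≤ 2Y} Q(m)² ≤ K Y`. [folklore] -/
theorem sum_Ioc_le_sqrt_of_sq {Q : ℕ → ℝ} {K : ℝ} {Y : ℕ} (hK : 0 ≤ K)
    (h : ∑ m ∈ Ioc Y (2 * Y), Q m ^ 2 ≤ K * Y) :
    ∑ m ∈ Ioc Y (2 * Y), Q m ≤ Real.sqrt K * Y := by
  have hY : (0 : ℝ) ≤ Y := Nat.cast_nonneg Y
  have hcs := sq_sum_le_card_mul_sum_sq (s := Ioc Y (2 * Y)) (f := Q)
  rw [Nat.card_Ioc, show 2 * Y - Y = Y by omega] at hcs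
  have h2 : (∑ m ∈ Ioc Y (2 * Y), Q m) ^ 2 ≤ (Real.sqrt K * Y) ^ 2 := by
    calc (∑ m ∈ Ioc Y (2 * Y), Q m) ^ 2 ≤ (Y : ℝ) * ∑ m ∈ Ioc Y (2 * Y), Q m ^ 2 := hcs
      _ ≤ (Y : ℝ) * (K * Y) := mul_le_mul_of_nonneg_left h hY
      _ = (Real.sqrt K * Y) ^ 2 := by rw [mul_pow, Real.sq_sqrt hK]; ring
  exact (abs_le_of_sq_le_sq h2 (by positivity)).trans' (le_abs_self _)

/-- **Dyadic decomposition** (p. 10–11: discard `y ≤ X/dW⁵`, then dyadic `Y` and Cauchy–Schwarz):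
if `0 ≤ Q ≤ B`, and `∑_{Y < m ≤ 2Y} Q(m)² ≤ K Y` for all integers `M₀ ≤ Y ≤ N`, then
`∑_{m=1}^{N} Q(m) ≤ M₀ B + 2√K N`. [cite: Lichtman2020, §3.2, (3.13)] -/
theorem sum_Icc_le_of_dyadic {Q : ℕ → ℝ} {B K : ℝ} {M₀ N : ℕ} (hQ0 : ∀ m, 0 ≤ Q m)
    (hQB : ∀ m, Q m ≤ B) (hM : 1 ≤ M₀) (hK : 0 ≤ K)
    (hms : ∀ Y : ℕ, M₀ ≤ Y → Y ≤ N → ∑ m ∈ Ioc Y (2 * Y), Q m ^ 2 ≤ K * Y) :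
    ∑ m ∈ Icc 1 N, Q m ≤ M₀ * B + 2 * Real.sqrt K * N := by
  have hB : 0 ≤ B := (hQ0 0).trans (hQB 0)
  have hsK : 0 ≤ Real.sqrt K := Real.sqrt_nonneg K
  have hIcc : ∀ n : ℕ, Icc 1 n = Ioc 0 n := fun n => by ext m; simp; omega
  -- the induction over dyadic blocks
  have hind : ∀ i : ℕ, 2 ^ i * M₀ ≤ 2 * N →
      ∑ m ∈ Ioc M₀ (min N (2 ^ i * M₀)), Q m ≤ Real.sqrt K * M₀ * (2 ^ i - 1) := by
    intro i
    induction i with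
    | zero =>
      intro _
      have : Ioc M₀ (min N (2 ^ 0 * M₀)) = ∅ := by
        rw [Finset.Ioc_eq_empty]; simp
      rw [this, Finset.sum_empty]; simp
    | succ i ih =>
      intro hi
      have hiN : 2 ^ i * M₀ ≤ N := by rw [pow_succ] at hi; linarith [hi]
      have h1 := ih (by omega)
      rw [min_eq_right hiN] at h1
      have hblock := sum_Ioc_le_sqrt_of_sq hK (hms (2 ^ i * M₀)
        (le_mul_of_one_le_left (Nat.zero_le _) (Nat.one_le_two_pow)) hiN)
      have hsplit := Finset.sum_Ioc_consecutive Q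
        (le_mul_of_one_le_left (Nat.zero_le _) (Nat.one_le_two_pow) : M₀ ≤ 2 ^ i * M₀)
        (by rw [pow_succ', mul_assoc]; exact Nat.le_mul_of_pos_left _ two_pos :
          2 ^ i * M₀ ≤ 2 ^ (i + 1) * M₀)
      have hsub : Ioc M₀ (min N (2 ^ (i + 1) * M₀)) ⊆ Ioc M₀ (2 ^ (i + 1) * M₀) :=
        Finset.Ioc_subset_Ioc le_rfl (min_le_right _ _)
      calc ∑ m ∈ Ioc M₀ (min N (2 ^ (i + 1) * M₀)), Q m
          ≤ ∑ m ∈ Ioc M₀ (2 ^ (i + 1) * M₀), Q m :=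
            Finset.sum_le_sum_of_subset_of_nonneg hsub fun _ _ _ => hQ0 _
        _ = ∑ m ∈ Ioc M₀ (2 ^ i * M₀), Q m + ∑ m ∈ Ioc (2 ^ i * M₀) (2 ^ (i + 1) * M₀), Q m := by
            rw [← hsplit]
        _ ≤ Real.sqrt K * M₀ * (2 ^ i - 1) + Real.sqrt K * (2 ^ i * M₀ : ℕ) := by
            refine add_le_add h1 ?_
            have : 2 ^ (i + 1) * M₀ = 2 * (2 ^ i * M₀) := by rw [pow_succ]; ring
            rw [this]
            exact hblock
        _ = Real.sqrt K * M₀ * (2 ^ (i + 1) - 1) := by push_cast; ring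
  -- the trivial part `m ≤ M₀`
  have htriv : ∀ n : ℕ, ∑ m ∈ Icc 1 n, Q m ≤ n * B := by
    intro n
    calc ∑ m ∈ Icc 1 n, Q m ≤ ∑ m ∈ Icc 1 n, B := Finset.sum_le_sum fun m _ => hQB m
      _ = n * B := by rw [Finset.sum_const, Nat.card_Icc, nsmul_eq_mul, Nat.add_sub_cancel]
  by_cases hNM : N ≤ M₀
  · calc ∑ m ∈ Icc 1 N, Q m ≤ N * B := htriv N
      _ ≤ M₀ * B := mul_le_mul_of_nonneg_right (by exact_mod_cast hNM) hB
      _ ≤ M₀ * B + 2 * Real.sqrt K * N := le_add_of_nonneg_right (by positivity)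
  push Not at hNM
  -- choose the minimal `i` with `N ≤ 2^i M₀`
  have hex : ∃ i : ℕ, N ≤ 2 ^ i * M₀ :=
    ⟨N, (Nat.lt_two_pow_self).le.trans (Nat.le_mul_of_pos_right _ hM)⟩
  classical
  set i := Nat.find hex with hi
  have hiN : N ≤ 2 ^ i * M₀ := Nat.find_spec hex
  have hi0 : i ≠ 0 := by
    intro h0
    rw [h0, pow_zero, one_mul] at hiN
    omega
  have hprev : ¬ N ≤ 2 ^ (i - 1) * M₀ := Nat.find_min hex (by omega)
  have h2N : 2 ^ i * M₀ ≤ 2 * N := by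
    have : 2 ^ i * M₀ = 2 * (2 ^ (i - 1) * M₀) := by
      rw [← mul_assoc, ← pow_succ']; congr 2; omega
    rw [this]; omega
  have hmain := hind i h2N
  rw [min_eq_left hiN] at hmain
  have hsplit := Finset.sum_Ioc_consecutive Q (Nat.zero_le M₀) hNM.le
  rw [hIcc, ← hsplit, ← hIcc]
  calc ∑ m ∈ Icc 1 M₀, Q m + ∑ m ∈ Ioc M₀ N, Q m
      ≤ M₀ * B + Real.sqrt K * M₀ * (2 ^ i - 1) := add_le_add (htriv M₀) hmain
    _ ≤ M₀ * B + Real.sqrt K * (2 ^ i * M₀ : ℕ) := by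
        push_cast; nlinarith [hsK, (by positivity : (0 : ℝ) ≤ M₀)]
    _ ≤ M₀ * B + Real.sqrt K * (2 * N : ℕ) := by
        gcongr
    _ = M₀ * B + 2 * Real.sqrt K * N := by push_cast; ring

/-- **Discretisation on an integer interval**: for integers `Y₁ ≤ Y₂` and `h ≥ 1`,
`∫_{Y₁}^{Y₂} F({n : x ≤ n ≤ x + h}) dx = ∑_{Y₁ < k ≤ Y₂} F({k, …, k+h-1})`. [folklore] -/
theorem integral_window_eq_sum_Ioc (F : Finset ℕ → ℝ) (Y₁ Y₂ h : ℕ) (hY : Y₁ ≤ Y₂) (hh : 1 ≤ h) :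
    ∫ x in (Y₁ : ℝ)..Y₂, F (Icc ⌈x⌉₊ ⌊x + h⌋₊) = ∑ k ∈ Ioc Y₁ Y₂, F (Icc k (k + h - 1)) := by
  obtain ⟨n, rfl⟩ := Nat.exists_eq_add_of_le hY
  have hint : ∀ k < n, IntervalIntegrable (fun x : ℝ => F (Icc ⌈x⌉₊ ⌊x + h⌋₊)) volume
      ((fun k : ℕ => ((Y₁ + k : ℕ) : ℝ)) k) ((fun k : ℕ => ((Y₁ + k : ℕ) : ℝ)) (k + 1)) := by
    intro k _
    refine (intervalIntegrable_const (c := F (Icc (Y₁ + k + 1) (Y₁ + k + 1 + h - 1)))).congr_uIoo ?_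
    intro x hx
    rw [Set.uIoo_of_le (by push_cast; linarith)] at hx
    simp only
    rw [Icc_ceil_floor_eq (k := Y₁ + k + 1) (by omega) hh (by push_cast at hx ⊢; linarith [hx.1])
      (by push_cast at hx ⊢; linarith [hx.2])]
  have hsplit := intervalIntegral.sum_integral_adjacent_intervals hint
  simp only [Nat.add_zero] at hsplit
  rw [← hsplit]
  clear hsplit hint hY
  induction n with
  | zero => simp
  | succ n ih =>
    rw [Finset.sum_range_succ, ih]
    have e1 : Ioc Y₁ (Y₁ + (n + 1)) = Ioc Y₁ (Y₁ + n + 1) := rfl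
    rw [e1, Finset.sum_Ioc_succ_top (by omega)]
    congr 1
    have hle : (((Y₁ + n : ℕ)) : ℝ) ≤ ((Y₁ + (n + 1) : ℕ) : ℝ) := by push_cast; linarith
    rw [intervalIntegral.integral_congr_Ioo_of_le
      (g := fun _ => F (Icc (Y₁ + n + 1) (Y₁ + n + 1 + h - 1))) hle ?_]
    · rw [intervalIntegral.integral_const]
      push_cast
      ring
    · intro x hx
      simp only
      rw [Icc_ceil_floor_eq (k := Y₁ + n + 1) (by omega) hh (by push_cast at hx ⊢; linarith [hx.1])
        (by push_cast at hx ⊢; linarith [hx.2])]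

/-! ### Window sums of `λχ`: trivial bound, dyadic bound, the bound for `U(j)` -/

/-- Trivial bound: a window of `ℓ + 1` integers and coefficients of modulus `≤ 1`. [folklore] -/
theorem norm_sum_filter_Icc_le (u ℓ : ℕ) (g : ℕ → ℂ) (hg : ∀ m, ‖g m‖ ≤ 1) (S : ℕ → Prop)
    [DecidablePred S] : ‖∑ m ∈ (Icc u (u + ℓ)).filter S, g m‖ ≤ ℓ + 1 := by
  calc ‖∑ m ∈ (Icc u (u + ℓ)).filter S, g m‖ ≤ ∑ m ∈ (Icc u (u + ℓ)).filter S, ‖g m‖ :=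
        norm_sum_le _ _
    _ ≤ ∑ m ∈ (Icc u (u + ℓ)).filter S, (1 : ℝ) := Finset.sum_le_sum fun m _ => hg m
    _ = #((Icc u (u + ℓ)).filter S) := by rw [Finset.sum_const, nsmul_eq_mul, mul_one]
    _ ≤ #(Icc u (u + ℓ)) := by exact_mod_cast Finset.card_filter_le _ _
    _ = ℓ + 1 := by rw [Nat.card_Icc]; push_cast [show u ≤ u + ℓ + 1 by omega]; ring

open ArithmeticFunction in
/-- `|λ(m)χ(m)| ≤ 1`. [folklore] -/
theorem norm_char_mul_liouville_le_one {n : ℕ} (χ : DirichletCharacter ℂ n) (m : ℕ) :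
    ‖χ (m : ZMod n) * ((liouville m : ℤ) : ℂ)‖ ≤ 1 := by
  rw [norm_mul]
  exact mul_le_one₀ (DirichletCharacter.norm_le_one χ _) (norm_nonneg _) (norm_liouville_le_one m)

open ArithmeticFunction in
/-- **The plain-window sum of `λχ` on average** (p. 10–11, (3.12)–(3.13) for one character): if the
mean square over every dyadic block `Y < m₀ ≤ 2Y`, `M₀ ≤ Y ≤ N`, of the window sums of length
`ℓ + 1` is `≤ C(ℓ+1)²Y/W¹⁰` (Proposition 3.4), then
`∑_{m₀ ≤ N} |∑_{m₀ ≤ m ≤ m₀+ℓ, m ∈ S} λ(m)χ(m)| ≤ (ℓ+1)(M₀ + 2√C N/W⁵)`. [cite: Lichtman2020, §3.2, (3.13)] -/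
theorem sum_plainWindow_le {n : ℕ} (χ : DirichletCharacter ℂ n) (S : ℕ → Prop) [DecidablePred S]
    {ℓ M₀ N : ℕ} {C W : ℝ} (hM : 1 ≤ M₀) (hC : 0 ≤ C) (hW : 0 < W)
    (hms : ∀ Y : ℕ, M₀ ≤ Y → Y ≤ N →
      ∑ k ∈ Ioc Y (2 * Y), ‖∑ m ∈ (Icc k (k + ℓ)).filter S,
          χ (m : ZMod n) * ((liouville m : ℤ) : ℂ)‖ ^ 2 ≤ C * (((ℓ : ℝ) + 1) ^ 2 * Y / W ^ 10)) :
    ∑ m₀ ∈ Icc 1 N, ‖∑ m ∈ (Icc m₀ (m₀ + ℓ)).filter S, χ (m : ZMod n) * ((liouville m : ℤ) : ℂ)‖ ≤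
      ((ℓ : ℝ) + 1) * (M₀ + 2 * Real.sqrt C * N / W ^ 5) := by
  have hK : 0 ≤ C * ((ℓ : ℝ) + 1) ^ 2 / W ^ 10 := by positivity
  have h := sum_Icc_le_of_dyadic (Q := fun m₀ => ‖∑ m ∈ (Icc m₀ (m₀ + ℓ)).filter S,
      χ (m : ZMod n) * ((liouville m : ℤ) : ℂ)‖) (B := (ℓ : ℝ) + 1)
      (K := C * ((ℓ : ℝ) + 1) ^ 2 / W ^ 10) (M₀ := M₀) (N := N) (fun _ => norm_nonneg _)
      (fun m₀ => norm_sum_filter_Icc_le m₀ ℓ _ (norm_char_mul_liouville_le_one χ) S) hM hK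
      (fun Y h1 h2 => by
        have := hms Y h1 h2
        calc _ ≤ C * (((ℓ : ℝ) + 1) ^ 2 * Y / W ^ 10) := this
          _ = C * ((ℓ : ℝ) + 1) ^ 2 / W ^ 10 * Y := by ring)
  have hsqrt : Real.sqrt (C * ((ℓ : ℝ) + 1) ^ 2 / W ^ 10) = Real.sqrt C * (ℓ + 1) / W ^ 5 := by
    rw [show C * ((ℓ : ℝ) + 1) ^ 2 / W ^ 10 = C * (((ℓ : ℝ) + 1) / W ^ 5) ^ 2 by ring,
      Real.sqrt_mul hC, Real.sqrt_sq (by positivity)]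
    ring
  rw [hsqrt] at h
  calc _ ≤ (M₀ : ℝ) * ((ℓ : ℝ) + 1) + 2 * (Real.sqrt C * (ℓ + 1) / W ^ 5) * N := h
    _ = ((ℓ : ℝ) + 1) * (M₀ + 2 * Real.sqrt C * N / W ^ 5) := by ring

/-- Window lengths after dividing by `c`: for `c ≤ j` and `r < c`, `⌊(r+j)/c⌋ ≤ j`. [folklore] -/
theorem add_div_le_of_le {c r j : ℕ} (hc : 0 < c) (hr : r < c) (hcj : c ≤ j) : (r + j) / c ≤ j := by
  rcases Nat.lt_or_ge c 2 with h | h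
  · have hc1 : c = 1 := by omega
    subst hc1
    have : r = 0 := by omega
    subst this
    simp
  · calc (r + j) / c ≤ (2 * j) / c := Nat.div_le_div_right (by omega)
      _ ≤ (2 * j) / 2 := Nat.div_le_div_left h two_pos
      _ = j := by omega

open ArithmeticFunction in
/-- **The bound for `U(j)`** (p. 10–11, (3.11)–(3.13) summed over residues, divisors and
characters): for `q ≥ 1`, a set `S` invariant under the divisors of `q`, and `j` with
`q(H/W⁵ + 1) ≤ j ≤ H - 1`, Proposition 3.4 (discretised, for the moduli `q/c`, window lengths
`h ∈ [H/W⁵, H]` and blocks `M₀ ≤ Y ≤ N`) gives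
`∑_{n₀ ≤ N} |∑_{n₀ ≤ m ≤ n₀+j, m ∈ S} λ(m) e(ma/q)| ≤ 3jq (M₀ + 2√C N/W⁵)`.
[cite: Lichtman2020, §3.2, (3.11)–(3.13)] -/
theorem sum_twistedWindow_le {q N M₀ H j : ℕ} {a : ℤ} {C W : ℝ} (S : ℕ → Prop) [DecidablePred S]
    (hq : 0 < q) (hS : ∀ c ∈ q.divisors, ∀ m, S (c * m) ↔ S m) (hW : 0 < W) (hC : 0 ≤ C)
    (hM : 1 ≤ M₀) (hN : 1 ≤ N) (hjlo : (q : ℝ) * (H / W ^ 5 + 1) ≤ j) (hjhi : j + 1 ≤ H)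
    (h34 : ∀ c ∈ q.divisors, ∀ χ : DirichletCharacter ℂ (q / c), ∀ h : ℕ,
      (H : ℝ) / W ^ 5 ≤ h → h ≤ H → ∀ Y : ℕ, M₀ ≤ Y → Y ≤ N →
        ∑ k ∈ Ioc Y (2 * Y), ‖∑ m ∈ (Icc k (k + h - 1)).filter S,
            χ (m : ZMod (q / c)) * ((liouville m : ℤ) : ℂ)‖ ^ 2 ≤ C * ((h : ℝ) ^ 2 * Y / W ^ 10)) :
    ∑ n₀ ∈ Icc 1 N, ‖∑ m ∈ (Icc n₀ (n₀ + j)).filter S,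
        ((liouville m : ℤ) : ℂ) * (𝐞 ((m : ℝ) * (a / q)) : ℂ)‖ ≤
      3 * j * q * (M₀ + 2 * Real.sqrt C * N / W ^ 5) := by
  have hq1 : (1 : ℝ) ≤ q := by exact_mod_cast hq
  have hHW : (0 : ℝ) ≤ H / W ^ 5 := by positivity
  have hqj : q ≤ j := by
    have : (q : ℝ) ≤ j := by nlinarith
    exact_mod_cast this
  set R : ℝ := (M₀ : ℝ) + 2 * Real.sqrt C * N / W ^ 5 with hR
  have hR0 : 0 ≤ R := by positivity
  -- step 1: residues, gcd, characters (pointwise in `n₀`), then swap the sums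
  calc ∑ n₀ ∈ Icc 1 N, ‖∑ m ∈ (Icc n₀ (n₀ + j)).filter S,
          ((liouville m : ℤ) : ℂ) * (𝐞 ((m : ℝ) * (a / q)) : ℂ)‖
      ≤ ∑ n₀ ∈ Icc 1 N, ∑ c ∈ q.divisors, ∑ χ : DirichletCharacter ℂ (q / c),
          ‖∑ m ∈ (Icc ((n₀ + c - 1) / c) ((n₀ + j) / c)).filter S,
            χ (m : ZMod (q / c)) * ((liouville m : ℤ) : ℂ)‖ :=
        Finset.sum_le_sum fun n₀ _ => norm_twistedWindow_le_sum_divisors hq a S hS _ _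
    _ = ∑ c ∈ q.divisors, ∑ χ : DirichletCharacter ℂ (q / c), ∑ n₀ ∈ Icc 1 N,
          ‖∑ m ∈ (Icc ((n₀ + c - 1) / c) ((n₀ + j) / c)).filter S,
            χ (m : ZMod (q / c)) * ((liouville m : ℤ) : ℂ)‖ := by
        rw [Finset.sum_comm]
        exact Finset.sum_congr rfl fun c _ => Finset.sum_comm
    _ ≤ ∑ c ∈ q.divisors, ∑ _χ : DirichletCharacter ℂ (q / c), ((j : ℝ) + 2 * c) * R := by
        refine Finset.sum_le_sum fun c hc => Finset.sum_le_sum fun χ _ => ?_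
        have hc0 : 0 < c := Nat.pos_of_mem_divisors hc
        have hcq : c ≤ q := Nat.divisor_le hc
        have hc0' : (0 : ℝ) < c := by exact_mod_cast hc0
        -- step 2: divided windows → plain windows
        refine (sum_window_cdiv_le hc0 N j (fun s => ‖∑ m ∈ s.filter S,
          χ (m : ZMod (q / c)) * ((liouville m : ℤ) : ℂ)‖) (fun _ => norm_nonneg _)
          (by simp)).trans ?_
        -- step 3: each residue `r` is a plain-window average of admissible length
        have hr : ∀ r ∈ range c,
            ∑ m₀ ∈ Icc 1 ((N - 1) / c + 1), ‖∑ m ∈ (Icc m₀ (m₀ + ((r + j) / c -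
              if r = 0 then 0 else 1))).filter S, χ (m : ZMod (q / c)) * ((liouville m : ℤ) : ℂ)‖ ≤
              ((j : ℝ) / c + 2) * R := by
          intro r hr
          rw [Finset.mem_range] at hr
          set ℓ : ℕ := (r + j) / c - if r = 0 then 0 else 1 with hℓ
          -- the window length `ℓ + 1 ∈ [H/W⁵, H]`, and `ℓ + 1 ≤ j/c + 2`
          have hℓj : (r + j) / c ≤ j := add_div_le_of_le hc0 hr (hcq.trans hqj)
          have hℓle : ℓ ≤ (r + j) / c := Nat.sub_le _ _
          have hℓge : j / q ≤ ℓ + 1 := by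
            have h1 : j / q ≤ j / c := Nat.div_le_div_left hcq hc0
            have h2 : j / c ≤ (r + j) / c := Nat.div_le_div_right (by omega)
            rw [hℓ]; split_ifs <;> omega
          have hlen_hi : ℓ + 1 ≤ H := by omega
          have hlen_lo : (H : ℝ) / W ^ 5 ≤ ((ℓ + 1 : ℕ) : ℝ) := by
            -- `j/q - 1 < ⌊j/q⌋ ≤ ℓ`
            have hdm := Nat.div_add_mod j q
            have hmod := Nat.mod_lt j hq
            have e1 : (q : ℝ) * ((j / q : ℕ) : ℝ) + ((j % q : ℕ) : ℝ) = j := by exact_mod_cast hdm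
            have e2 : ((j % q : ℕ) : ℝ) + 1 ≤ q := by exact_mod_cast hmod
            have e3 : ((j / q : ℕ) : ℝ) ≤ ℓ + 1 := by exact_mod_cast hℓge
            have hq0 : (0 : ℝ) < q := by linarith
            -- `q ⌊j/q⌋ ≥ j - q + 1 ≥ q H/W⁵ + 1`
            have e4 : (q : ℝ) * (H / W ^ 5) + 1 ≤ (q : ℝ) * ((j / q : ℕ) : ℝ) := by nlinarith
            have e5 : (H : ℝ) / W ^ 5 ≤ ((j / q : ℕ) : ℝ) := by
              by_contra hcon
              push Not at hcon
              nlinarith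
            push_cast
            linarith
          have hlen2 : ((ℓ : ℝ) + 1) ≤ (j : ℝ) / c + 2 := by
            have e1 : (ℓ : ℝ) ≤ (((r + j) / c : ℕ) : ℝ) := by exact_mod_cast hℓle
            have e2 : (((r + j) / c : ℕ) : ℝ) ≤ ((r + j : ℕ) : ℝ) / c := Nat.cast_div_le
            have e3 : ((r + j : ℕ) : ℝ) / c ≤ (j : ℝ) / c + 1 := by
              rw [div_add_one hc0'.ne', div_le_div_iff_of_pos_right hc0']
              push_cast
              have : (r : ℝ) ≤ c := by exact_mod_cast hr.le
              linarith
            linarith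
          have hNc : (N - 1) / c + 1 ≤ N := by
            have := Nat.div_le_self (N - 1) c
            omega
          -- Proposition 3.4 for this character and this window length
          have hV := sum_plainWindow_le χ S (ℓ := ℓ) (M₀ := M₀) (N := (N - 1) / c + 1) (C := C)
            (W := W) hM hC hW (fun Y h1 h2 => by
              have h := h34 c hc χ (ℓ + 1) hlen_lo hlen_hi Y h1 (h2.trans hNc)
              have hkey : ∀ k : ℕ, k + (ℓ + 1) - 1 = k + ℓ := fun k => by omega
              simp only [hkey] at h
              push_cast at h
              exact h)
          refine hV.trans ?_
          have hNc' : (((N - 1) / c + 1 : ℕ) : ℝ) ≤ N := by exact_mod_cast hNc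
          calc ((ℓ : ℝ) + 1) * (M₀ + 2 * Real.sqrt C * (((N - 1) / c + 1 : ℕ) : ℝ) / W ^ 5)
              ≤ ((ℓ : ℝ) + 1) * R := by
                refine mul_le_mul_of_nonneg_left ?_ (by positivity)
                rw [hR]
                gcongr
            _ ≤ ((j : ℝ) / c + 2) * R := mul_le_mul_of_nonneg_right hlen2 hR0
        refine (Finset.sum_le_sum hr).trans (le_of_eq ?_)
        rw [Finset.sum_const, Finset.card_range, nsmul_eq_mul]
        field_simp
    _ ≤ ∑ c ∈ q.divisors, ((q / c).totient : ℝ) * (((j : ℝ) + 2 * q) * R) := by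
        refine Finset.sum_le_sum fun c hc => ?_
        have hc0 : 0 < c := Nat.pos_of_mem_divisors hc
        have hcq : c ≤ q := Nat.divisor_le hc
        haveI : NeZero (q / c) :=
          ⟨(Nat.div_pos (Nat.le_of_dvd hq (Nat.dvd_of_mem_divisors hc)) hc0).ne'⟩
        rw [Finset.sum_const, Finset.card_univ, ← Nat.card_eq_fintype_card,
          DirichletCharacter.card_eq_totient_of_hasEnoughRootsOfUnity ℂ (q / c), nsmul_eq_mul]
        refine mul_le_mul_of_nonneg_left (mul_le_mul_of_nonneg_right ?_ hR0) (Nat.cast_nonneg _)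
        have : (c : ℝ) ≤ q := by exact_mod_cast hcq
        linarith
    _ = q * (((j : ℝ) + 2 * q) * R) := by rw [← Finset.sum_mul, sum_divisors_totient_div]
    _ ≤ q * ((3 * j) * R) := by
        refine mul_le_mul_of_nonneg_left (mul_le_mul_of_nonneg_right ?_ hR0) (by positivity)
        have : (q : ℝ) ≤ j := by exact_mod_cast hqj
        linarith
    _ = 3 * j * q * R := by ring


/-! ### Numerics -/

/-- Numerics of the major arcs, I: the Abel windows are long enough for Proposition 3.4,
`q(H/W⁵ + 1) ≤ H/d - 3` when `d, q ≤ W`, `W ≥ 2`, `H ≥ W⁶`. [folklore] -/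
theorem majorArc_threshold_le {H d q W : ℝ} (hW : 2 ≤ W) (hd1 : 1 ≤ d) (hdW : d ≤ W)
    (hqW : q ≤ W) (hH : W ^ 6 ≤ H) :
    q * (H / W ^ 5 + 1) ≤ H / d - 3 := by
  have hW0 : 0 < W := by linarith
  have hd0 : 0 < d := by linarith
  have hH0 : 0 ≤ H := le_trans (by positivity) hH
  -- (a) `q(H/W⁵ + 1) ≤ H/W⁴ + W`
  have ha : q * (H / W ^ 5 + 1) ≤ H / W ^ 4 + W := by
    calc q * (H / W ^ 5 + 1) ≤ W * (H / W ^ 5 + 1) := by gcongr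
      _ = H / W ^ 4 + W := by field_simp
  -- (b) `H/W ≤ H/d`
  have hb : H / W ≤ H / d := div_le_div_of_nonneg_left hH0 hd0 hdW
  -- (c) `H/W - H/W⁴ ≥ W⁵ - W²`
  have hc : W ^ 5 - W ^ 2 ≤ H / W - H / W ^ 4 := by
    have e1 : H / W - H / W ^ 4 = H * ((W ^ 3 - 1) / W ^ 4) := by field_simp
    have e2 : W ^ 5 - W ^ 2 = W ^ 6 * ((W ^ 3 - 1) / W ^ 4) := by field_simp
    have e3 : 0 ≤ (W ^ 3 - 1) / W ^ 4 := by
      apply div_nonneg _ (by positivity)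
      nlinarith [one_le_pow₀ (by linarith : (1 : ℝ) ≤ W) (n := 3)]
    rw [e1, e2]
    exact mul_le_mul_of_nonneg_right hH e3
  -- (d) `W⁵ - W² ≥ W + 3`
  have hd : W + 3 ≤ W ^ 5 - W ^ 2 := by
    have e1 : 8 * W ^ 2 ≤ W ^ 5 := by
      have : (8 : ℝ) ≤ W ^ 3 := by nlinarith
      nlinarith [sq_nonneg W]
    nlinarith
  linarith

/-- Numerics of the major arcs, II: the assembly of (3.9)–(3.11),
`I_𝔐 ≪ I_{H/d} + (W⁴/qH)(∑_{small h} hX + ∑_h qhX/W⁵) ≪ HX/(dW)`. [cite: Lichtman2020, §3.2, (3.9)–(3.11)] -/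
theorem majorArc_numerics {H X d q W L T ε C₁ A₁ A₂ : ℝ} (hW : 2 ≤ W) (hd1 : 1 ≤ d) (hdW : d ≤ W)
    (hq1 : 1 ≤ q) (hqW : q ≤ W) (hH : W ^ 6 ≤ H) (hX : 0 ≤ X) (hC₁ : 0 ≤ C₁) (hL0 : 0 ≤ L)
    (hL : L ≤ H / d) (hε0 : 0 ≤ ε) (hε : ε ≤ 2 * Real.pi * W ^ 4 / (q * H))
    (hT : T = q * (H / W ^ 5 + 1))
    (hA₁ : A₁ ≤ 2 * (C₁ * L * q * X / W ^ 5))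
    (hA₂ : A₂ ≤ L * (C₁ * L * q * X / W ^ 5) + (T + 1) * (X * (T + 1))) :
    A₁ + ε * A₂ ≤ (2 * C₁ + 2 * Real.pi * C₁ + 8 * Real.pi) * (H * X / (d * W)) := by
  have hW0 : 0 < W := by linarith
  have hW1 : 1 ≤ W := by linarith
  have hd0 : 0 < d := by linarith
  have hq0 : 0 < q := by linarith
  have hH0 : 0 < H := lt_of_lt_of_le (by positivity) hH
  have hπ := Real.pi_pos.le
  set U : ℝ := H * X / (d * W) with hU
  have hU0 : 0 ≤ U := by positivity
  -- (i) the two long windows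
  have h1 : C₁ * L * q * X / W ^ 5 ≤ C₁ * U := by
    calc C₁ * L * q * X / W ^ 5 ≤ C₁ * (H / d) * W * X / W ^ 5 := by gcongr
      _ = C₁ * U / W ^ 3 := by rw [hU]; field_simp
      _ ≤ C₁ * U := div_le_self (by positivity) (one_le_pow₀ hW1)
  -- (ii) the long Abel windows
  have h2 : ε * (L * (C₁ * L * q * X / W ^ 5)) ≤ 2 * Real.pi * C₁ * U := by
    calc ε * (L * (C₁ * L * q * X / W ^ 5))
        ≤ (2 * Real.pi * W ^ 4 / (q * H)) * ((H / d) * (C₁ * (H / d) * q * X / W ^ 5)) := by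
          gcongr
      _ = 2 * Real.pi * C₁ * U / d := by rw [hU]; field_simp
      _ ≤ 2 * Real.pi * C₁ * U := div_le_self (by positivity) hd1
  -- (iii) the short Abel windows
  have hHW5 : 2 ≤ H / W ^ 5 := by
    rw [le_div_iff₀ (by positivity)]
    calc 2 * W ^ 5 ≤ W * W ^ 5 := by gcongr
      _ = W ^ 6 := by ring
      _ ≤ H := hH
  have hT1 : T + 1 ≤ 2 * (q * (H / W ^ 5)) := by rw [hT]; nlinarith
  have hT0 : 0 ≤ T + 1 := by rw [hT]; positivity
  have h3 : ε * ((T + 1) * (X * (T + 1))) ≤ 8 * Real.pi * U := by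
    calc ε * ((T + 1) * (X * (T + 1)))
        ≤ (2 * Real.pi * W ^ 4 / (q * H)) * ((2 * (q * (H / W ^ 5))) * (X * (2 * (q * (H / W ^ 5))))) := by
          gcongr
      _ = 8 * Real.pi * U * (q * d / W ^ 5) := by rw [hU]; field_simp; ring
      _ ≤ 8 * Real.pi * U * 1 := by
          refine mul_le_mul_of_nonneg_left ?_ (by positivity)
          rw [div_le_one (by positivity)]
          calc q * d ≤ W * W := by gcongr
            _ = W ^ 2 := by ring
            _ ≤ W ^ 5 := pow_le_pow_right₀ hW1 (by norm_num)
      _ = 8 * Real.pi * U := mul_one _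
  have hA₂' : ε * A₂ ≤ ε * (L * (C₁ * L * q * X / W ^ 5) + (T + 1) * (X * (T + 1))) :=
    mul_le_mul_of_nonneg_left hA₂ hε0
  rw [mul_add] at hA₂'
  nlinarith


/-- `⌊a/b⌋ ≥ a/b - 1` for naturals, in `ℝ`. [folklore] -/
theorem sub_one_le_natDiv (a : ℕ) {b : ℕ} (hb : 0 < b) : (a : ℝ) / b - 1 ≤ ((a / b : ℕ) : ℝ) := by
  have h1 := Nat.div_add_mod a b
  have h2 := Nat.mod_lt a hb
  have hb0 : (0 : ℝ) < b := by exact_mod_cast hb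
  have e1 : (b : ℝ) * ((a / b : ℕ) : ℝ) + ((a % b : ℕ) : ℝ) = a := by exact_mod_cast h1
  have e2 : ((a % b : ℕ) : ℝ) + 1 ≤ b := by exact_mod_cast h2
  rw [sub_le_iff_le_add, div_le_iff₀ hb0]
  nlinarith

/-! ### The major arc bound at a fixed scale -/

open ArithmeticFunction in
/-- **Lichtman's major arc argument at a fixed `X`** (pp. 10–11, "Proof of Proposition 3.2 from
Proposition 3.4"): for `α = a/q + θ`, `q ≤ W`, `|θ| ≤ W⁴/(qH)`, `d ≤ W`, a set `S` invariant under
the divisors of `q`, and the mean-square bound of Proposition 3.4 (discretised) for the moduli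
`q/c` with `c ∣ q`, the window lengths `h ∈ [H/W⁵, H]` and the blocks `X/W⁶ ≤ Y ≤ X`, one has
`∑_{k ≤ X} |∑_{k ≤ md ≤ k+H-1, m ∈ S} λ(m) e(mα)| ≤ C' HX/(dW)` with `C' = 2C₁ + 2πC₁ + 8π`,
`C₁ = 6 + 12√C`.  Steps: Abel summation in `θ` ((3.9)), the factor `d` from `k ↦ ⌈k/d⌉`, residues
mod `q`, extraction of `c = (b, q)`, orthogonality ((3.12)), divided windows as plain windows,
the trivial bound below `X/dW⁵` and dyadic Cauchy–Schwarz above ((3.13)), and the numerics of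
(3.10)–(3.11). [cite: Lichtman2020, Proposition 3.2 (proof), pp. 10–11] -/
theorem majorArc_fixed_bound {X H d q : ℕ} {a : ℤ} {θ W C : ℝ} (S : ℕ → Prop) [DecidablePred S]
    (hX : 1 ≤ X) (hd : 1 ≤ d) (hdW : (d : ℝ) ≤ W) (hq : 1 ≤ q) (hqW : (q : ℝ) ≤ W) (hW : 2 ≤ W)
    (hHW : W ^ 6 ≤ H) (hXW : W ^ 6 ≤ X) (hθ : |θ| ≤ W ^ 4 / (q * H)) (hC : 0 ≤ C)
    (hS : ∀ c ∈ q.divisors, ∀ m, S (c * m) ↔ S m)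
    (h34 : ∀ c ∈ q.divisors, ∀ χ : DirichletCharacter ℂ (q / c), ∀ h : ℕ,
      (H : ℝ) / W ^ 5 ≤ h → h ≤ H → ∀ Y : ℕ, (X : ℝ) / W ^ 6 ≤ Y → Y ≤ X →
        ∑ k ∈ Ioc Y (2 * Y), ‖∑ m ∈ (Icc k (k + h - 1)).filter S,
            χ (m : ZMod (q / c)) * ((liouville m : ℤ) : ℂ)‖ ^ 2 ≤ C * ((h : ℝ) ^ 2 * Y / W ^ 10)) :
    ∑ k ∈ Icc 1 X, ‖∑ m ∈ (windowDiv d H k).filter S,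
        ((liouville m : ℤ) : ℂ) * (𝐞 ((m : ℝ) * (a / q + θ)) : ℂ)‖ ≤
      (2 * (6 + 12 * Real.sqrt C) + 2 * Real.pi * (6 + 12 * Real.sqrt C) + 8 * Real.pi) *
        ((H : ℝ) * X / (d * W)) := by
  -- positivity bookkeeping
  have hW0 : (0 : ℝ) < W := by linarith
  have hW1 : (1 : ℝ) ≤ W := by linarith
  have hd0 : 0 < d := hd
  have hq0 : 0 < q := hq
  have hd1 : (1 : ℝ) ≤ d := by exact_mod_cast hd
  have hq1 : (1 : ℝ) ≤ q := by exact_mod_cast hq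
  have hW6 : (64 : ℝ) ≤ W ^ 6 := by
    have := pow_le_pow_left₀ (by norm_num : (0 : ℝ) ≤ 2) hW 6
    norm_num at this
    exact this
  have hH64 : (64 : ℝ) ≤ H := hW6.trans hHW
  have hH1 : 1 ≤ H := by exact_mod_cast (show (1 : ℝ) ≤ H by linarith)
  have hX0 : (0 : ℝ) ≤ X := Nat.cast_nonneg X
  -- `ε = |e(θ) - 1| ≤ 2π W⁴/(qH)`
  obtain ⟨ε, hεdef⟩ : ∃ ε : ℝ, ε = ‖(𝐞 θ : ℂ) - 1‖ := ⟨_, rfl⟩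
  have hε0 : 0 ≤ ε := by rw [hεdef]; exact norm_nonneg _
  have hε : ε ≤ 2 * Real.pi * W ^ 4 / (q * H) := by
    calc ε ≤ 2 * Real.pi * |θ| := by rw [hεdef]; exact norm_fourierChar_sub_one_le θ
      _ ≤ 2 * Real.pi * (W ^ 4 / (q * H)) :=
          mul_le_mul_of_nonneg_left hθ (by positivity)
      _ = _ := by ring
  -- the window sums `P(n₀, j)` with the additive character `e(·a/q)` (kept opaque)
  obtain ⟨P, hP⟩ : ∃ P : ℕ → ℕ → ℝ, ∀ n₀ j, P n₀ j = ‖∑ m ∈ (Icc n₀ (n₀ + j)).filter S,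
      ((liouville m : ℤ) : ℂ) * (𝐞 ((m : ℝ) * (a / q)) : ℂ)‖ := ⟨_, fun _ _ => rfl⟩
  have hP0 : ∀ n₀ j, 0 ≤ P n₀ j := fun n₀ j => by rw [hP]; exact norm_nonneg _
  have hg1 : ∀ m : ℕ, ‖((liouville m : ℤ) : ℂ) * (𝐞 ((m : ℝ) * (a / q)) : ℂ)‖ ≤ 1 := by
    intro m
    rw [norm_mul, norm_fourierChar, mul_one]
    exact norm_liouville_le_one m
  have hPtriv : ∀ n₀ j, P n₀ j ≤ j + 1 := fun n₀ j => by
    rw [hP]; exact norm_sum_filter_Icc_le n₀ j _ hg1 S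
  obtain ⟨L, hLdef⟩ : ∃ L : ℕ, L = (H - 1) / d := ⟨_, rfl⟩
  -- Step 1: Abel summation on each window
  have hterm : ∀ k ∈ Icc 1 X,
      ‖∑ m ∈ (windowDiv d H k).filter S,
          ((liouville m : ℤ) : ℂ) * (𝐞 ((m : ℝ) * (a / q + θ)) : ℂ)‖ ≤
        P ((k + d - 1) / d) (L - 1) + P ((k + d - 1) / d) L +
          ε * ∑ j ∈ range L, P ((k + d - 1) / d) j := by
    intro k hk
    have hk1 : 1 ≤ k := (Finset.mem_Icc.mp hk).1
    have hsum0 : 0 ≤ ∑ j ∈ range L, P ((k + d - 1) / d) j :=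
      Finset.sum_nonneg fun j _ => hP0 _ _
    have hRHS0 : 0 ≤ P ((k + d - 1) / d) (L - 1) + P ((k + d - 1) / d) L +
        ε * ∑ j ∈ range L, P ((k + d - 1) / d) j :=
      add_nonneg (add_nonneg (hP0 _ _) (hP0 _ _)) (mul_nonneg hε0 hsum0)
    rw [windowDiv_eq_Icc hd0 hk1]
    obtain ⟨m₀, hm₀⟩ : ∃ m₀ : ℕ, m₀ = (k + d - 1) / d := ⟨_, rfl⟩
    obtain ⟨M, hM⟩ : ∃ M : ℕ, M = (k + H - 1) / d := ⟨_, rfl⟩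
    rw [← hm₀, ← hM]
    by_cases hle : m₀ ≤ M
    · obtain ⟨n, hn⟩ := Nat.exists_eq_add_of_le hle
      -- `n ∈ {L-1, L}`
      have hnL : n ≤ L ∧ L ≤ n + 1 := by
        have e₁ := Nat.div_add_mod (k + d - 1) d
        have r₁ := Nat.mod_lt (k + d - 1) hd0
        have e₂ := Nat.div_add_mod (k + H - 1) d
        have r₂ := Nat.mod_lt (k + H - 1) hd0
        have e₃ := Nat.div_add_mod (H - 1) d
        have r₃ := Nat.mod_lt (H - 1) hd0
        rw [← hm₀] at e₁
        rw [← hM, hn, Nat.mul_add] at e₂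
        rw [← hLdef] at e₃
        have g1 : d * n < d * (L + 1) := by
          rw [Nat.mul_add, Nat.mul_one]
          generalize d * m₀ = A at e₁ e₂
          generalize d * n = B at e₂
          generalize d * L = E at e₃
          omega
        have g2 : d * L < d * (n + 2) := by
          rw [Nat.mul_add]
          generalize d * m₀ = A at e₁ e₂
          generalize d * n = B at e₂
          generalize d * L = E at e₃
          omega
        exact ⟨Nat.lt_succ_iff.mp (Nat.lt_of_mul_lt_mul_left g1),
          by have := Nat.lt_of_mul_lt_mul_left g2; omega⟩
      rw [hn]
      -- factor `e(mα) = e(ma/q) e(mθ)` and move `𝟙_S` into the coefficient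
      obtain ⟨f, hf⟩ : ∃ f : ℕ → ℂ, ∀ m, f m = if S m then
          ((liouville m : ℤ) : ℂ) * (𝐞 ((m : ℝ) * (a / q)) : ℂ) else 0 := ⟨_, fun _ => rfl⟩
      have hrew : ∀ s : Finset ℕ, ∑ m ∈ s.filter S,
          ((liouville m : ℤ) : ℂ) * (𝐞 ((m : ℝ) * (a / q + θ)) : ℂ) =
            ∑ m ∈ s, f m * (𝐞 ((m : ℝ) * θ) : ℂ) := by
        intro s
        rw [Finset.sum_filter]
        refine Finset.sum_congr rfl fun m _ => ?_
        rw [hf]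
        split_ifs
        · rw [mul_add, AddChar.map_add_eq_mul, Circle.coe_mul]; ring
        · rw [zero_mul]
      have hPf : ∀ j, ‖∑ m ∈ Icc m₀ (m₀ + j), f m‖ = P m₀ j := by
        intro j
        rw [hP, Finset.sum_filter]
        simp only [hf]
      rw [hrew]
      refine (norm_sum_Icc_mul_fourierChar_le f θ m₀ n).trans ?_
      rw [hPf, ← hεdef]
      simp only [hPf]
      -- `P(m₀, n) ≤ P(m₀, L-1) + P(m₀, L)` and `∑_{j<n} ≤ ∑_{j<L}`
      have h1 : P m₀ n ≤ P m₀ (L - 1) + P m₀ L := by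
        rcases Nat.eq_or_lt_of_le hnL.1 with h | h
        · rw [h]; linarith [hP0 m₀ (L - 1)]
        · have : n = L - 1 := by omega
          rw [this]; linarith [hP0 m₀ L]
      have h2 : ∑ j ∈ range n, P m₀ j ≤ ∑ j ∈ range L, P m₀ j :=
        Finset.sum_le_sum_of_subset_of_nonneg (Finset.range_subset_range.mpr hnL.1)
          fun _ _ _ => hP0 _ _
      have := mul_le_mul_of_nonneg_left h2 hε0
      linarith
    · -- empty window
      have hempty : Icc m₀ M = ∅ := Finset.Icc_eq_empty_of_lt (by omega)
      rw [hempty, Finset.filter_empty, Finset.sum_empty, norm_zero]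
      subst hm₀
      exact hRHS0
  -- Step 2: sum over `k`; the sums `I'(j) = ∑_k P(⌈k/d⌉, j)` (kept opaque)
  obtain ⟨I', hI'⟩ : ∃ I' : ℕ → ℝ, ∀ j, I' j = ∑ k ∈ Icc 1 X, P ((k + d - 1) / d) j :=
    ⟨_, fun _ => rfl⟩
  have hstep2 : ∑ k ∈ Icc 1 X, ‖∑ m ∈ (windowDiv d H k).filter S,
      ((liouville m : ℤ) : ℂ) * (𝐞 ((m : ℝ) * (a / q + θ)) : ℂ)‖ ≤
        I' (L - 1) + I' L + ε * ∑ j ∈ range L, I' j := by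
    refine (Finset.sum_le_sum hterm).trans (le_of_eq ?_)
    simp only [hI']
    rw [Finset.sum_add_distrib, Finset.sum_add_distrib, ← Finset.mul_sum, Finset.sum_comm]
  -- Step 3a: the trivial bound `I'(j) ≤ X (j+1)`
  have hI'triv : ∀ j, I' j ≤ X * (j + 1) := by
    intro j
    rw [hI']
    calc ∑ k ∈ Icc 1 X, P ((k + d - 1) / d) j ≤ ∑ k ∈ Icc 1 X, ((j : ℝ) + 1) :=
          Finset.sum_le_sum fun k _ => hPtriv _ _
      _ = X * (j + 1) := by rw [Finset.sum_const, Nat.card_Icc, nsmul_eq_mul, Nat.add_sub_cancel]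
  -- Step 3b: the bound from Proposition 3.4 for `q(H/W⁵ + 1) ≤ j ≤ H - 1`
  obtain ⟨T, hT⟩ : ∃ T : ℝ, T = (q : ℝ) * (H / W ^ 5 + 1) := ⟨_, rfl⟩
  have hT0 : 0 ≤ T := by rw [hT]; positivity
  obtain ⟨C₁, hC₁⟩ : ∃ C₁ : ℝ, C₁ = 6 + 12 * Real.sqrt C := ⟨_, rfl⟩
  have hC₁0 : 0 ≤ C₁ := by rw [hC₁]; positivity
  obtain ⟨N, hNdef⟩ : ∃ N : ℕ, N = (X + d - 1) / d := ⟨_, rfl⟩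
  obtain ⟨M₀, hM₀⟩ : ∃ M₀ : ℕ, M₀ = ⌈(X : ℝ) / (d * W ^ 5)⌉₊ := ⟨_, rfl⟩
  have hN1 : 1 ≤ N := by rw [hNdef]; exact (Nat.le_div_iff_mul_le hd0).mpr (by omega)
  have hNX : N ≤ X := by
    rw [hNdef, Nat.div_le_iff_le_mul_add_pred hd0]
    have := Nat.mul_le_mul_right X hd
    rw [one_mul] at this
    omega
  have hdW5 : (d : ℝ) * W ^ 5 ≤ W ^ 6 := by
    calc (d : ℝ) * W ^ 5 ≤ W * W ^ 5 := by gcongr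
      _ = W ^ 6 := by ring
  have hdWX : (d : ℝ) * W ^ 5 ≤ X := hdW5.trans hXW
  have hM₀1 : 1 ≤ M₀ := by
    rw [hM₀, Nat.one_le_ceil_iff]
    positivity
  have hM₀ge : (X : ℝ) / W ^ 6 ≤ M₀ := by
    calc (X : ℝ) / W ^ 6 ≤ X / (d * W ^ 5) := div_le_div_of_nonneg_left hX0 (by positivity) hdW5
      _ ≤ M₀ := by rw [hM₀]; exact Nat.le_ceil _
  have hdM₀ : (d : ℝ) * M₀ ≤ 2 * X / W ^ 5 := by
    have h1 : (M₀ : ℝ) < X / (d * W ^ 5) + 1 := by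
      rw [hM₀]; exact Nat.ceil_lt_add_one (by positivity)
    have h2 : (d : ℝ) * M₀ ≤ d * (X / (d * W ^ 5) + 1) :=
      mul_le_mul_of_nonneg_left h1.le (by positivity)
    have h3 : (d : ℝ) * (X / (d * W ^ 5) + 1) = X / W ^ 5 + d := by field_simp
    have h4 : (d : ℝ) ≤ X / W ^ 5 := by rw [le_div_iff₀ (by positivity)]; exact hdWX
    rw [h3] at h2
    calc (d : ℝ) * M₀ ≤ X / W ^ 5 + d := h2
      _ ≤ X / W ^ 5 + X / W ^ 5 := by linarith
      _ = 2 * X / W ^ 5 := by ring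
  have hdN : (d : ℝ) * N ≤ 2 * X := by
    have h1 : d * N ≤ X + d - 1 := by rw [hNdef]; exact Nat.mul_div_le (X + d - 1) d
    have h2 : ((d * N : ℕ) : ℝ) ≤ ((X + d - 1 : ℕ) : ℝ) := by exact_mod_cast h1
    have h3 : (d : ℝ) ≤ X := by
      calc (d : ℝ) ≤ d * W ^ 5 := le_mul_of_one_le_right (by positivity) (one_le_pow₀ hW1)
        _ ≤ X := hdWX
    push_cast [show 1 ≤ X + d by omega] at h2
    linarith
  have hI'good : ∀ j : ℕ, T ≤ j → j + 1 ≤ H → I' j ≤ C₁ * j * q * X / W ^ 5 := by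
    intro j hjT hjH
    rw [hT] at hjT
    have hU := sum_twistedWindow_le (q := q) (N := N) (M₀ := M₀) (H := H) (j := j) (a := a)
      (C := C) (W := W) S hq0 hS hW0 hC hM₀1 hN1 hjT hjH (fun c hc χ h hh1 hh2 Y hY1 hY2 =>
        h34 c hc χ h hh1 hh2 Y (hM₀ge.trans (by exact_mod_cast hY1)) (hY2.trans hNX))
    simp only [← hP] at hU
    have hceil := sum_Icc_ceilDiv_le hd0 X (fun n₀ => P n₀ j) fun n₀ => hP0 n₀ j
    rw [← hNdef] at hceil
    rw [hI']
    calc ∑ k ∈ Icc 1 X, P ((k + d - 1) / d) j ≤ (d : ℝ) * ∑ n₀ ∈ Icc 1 N, P n₀ j := hceil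
      _ ≤ (d : ℝ) * (3 * j * q * (M₀ + 2 * Real.sqrt C * N / W ^ 5)) :=
          mul_le_mul_of_nonneg_left hU (by positivity)
      _ = 3 * j * q * ((d : ℝ) * M₀ + 2 * Real.sqrt C * ((d : ℝ) * N) / W ^ 5) := by ring
      _ ≤ 3 * j * q * (2 * X / W ^ 5 + 2 * Real.sqrt C * (2 * X) / W ^ 5) := by gcongr
      _ = C₁ * j * q * X / W ^ 5 := by rw [hC₁]; ring
  -- Step 4: the numerics
  have hLreal : (L : ℝ) ≤ H / d := by
    rw [hLdef]
    calc (((H - 1) / d : ℕ) : ℝ) ≤ ((H - 1 : ℕ) : ℝ) / d := Nat.cast_div_le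
      _ ≤ H / d := by
          gcongr
          exact_mod_cast Nat.sub_le H 1
  have hLge : (H : ℝ) / d - 2 ≤ L := by
    have h1 := sub_one_le_natDiv (H - 1) hd0
    have h2 : (((H - 1 : ℕ)) : ℝ) = H - 1 := by push_cast [hH1]; ring
    rw [h2, ← hLdef] at h1
    have h3 : (H : ℝ) / d - 1 ≤ ((H : ℝ) - 1) / d := by
      rw [sub_div]
      have : (1 : ℝ) / d ≤ 1 := by rw [div_le_one (by positivity)]; exact hd1
      linarith
    linarith
  have hthr : T ≤ (H : ℝ) / d - 3 := by rw [hT]; exact majorArc_threshold_le hW hd1 hdW hqW hHW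
  have hL1 : 1 ≤ L := by
    have : (0 : ℝ) < L := by linarith
    exact_mod_cast (show 0 < L by exact_mod_cast this)
  have hLH : L + 1 ≤ H := by
    have : L ≤ H - 1 := by rw [hLdef]; exact Nat.div_le_self _ _
    omega
  have hcastL1 : ((L - 1 : ℕ) : ℝ) = L - 1 := by push_cast [hL1]; ring
  have hTL1 : T ≤ ((L - 1 : ℕ) : ℝ) := by rw [hcastL1]; linarith
  have hTL : T ≤ (L : ℝ) := by linarith
  -- `A₁ = I'(L-1) + I'(L)`
  have hA₁ : I' (L - 1) + I' L ≤ 2 * (C₁ * L * q * X / W ^ 5) := by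
    have h1 := hI'good (L - 1) hTL1 (by omega)
    have h2 := hI'good L hTL hLH
    rw [hcastL1] at h1
    have h3 : C₁ * ((L : ℝ) - 1) * q * X / W ^ 5 ≤ C₁ * L * q * X / W ^ 5 := by
      have e1 : 0 ≤ C₁ * q * X / W ^ 5 := by positivity
      have e2 : C₁ * ((L : ℝ) - 1) * q * X / W ^ 5 =
          C₁ * L * q * X / W ^ 5 - C₁ * q * X / W ^ 5 := by ring
      linarith
    linarith
  -- `A₂ = ∑_{j<L} I'(j)`
  have hA₂ : ∑ j ∈ range L, I' j ≤ L * (C₁ * L * q * X / W ^ 5) + (T + 1) * (X * (T + 1)) := by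
    have hpt : ∀ j ∈ range L, I' j ≤
        C₁ * L * q * X / W ^ 5 + (if (j : ℝ) < T then X * (T + 1) else 0) := by
      intro j hj
      rw [Finset.mem_range] at hj
      by_cases hjT : (j : ℝ) < T
      · rw [if_pos hjT]
        have h1 := hI'triv j
        have h2 : (X : ℝ) * (j + 1) ≤ X * (T + 1) := by gcongr
        have h3 : 0 ≤ C₁ * L * q * X / W ^ 5 := by positivity
        linarith
      · rw [if_neg hjT, add_zero]
        push Not at hjT
        have h1 := hI'good j hjT (by omega)
        have hjL : (j : ℝ) ≤ L := by exact_mod_cast hj.le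
        have h2 : C₁ * j * q * X / W ^ 5 ≤ C₁ * L * q * X / W ^ 5 := by gcongr
        linarith
    refine (Finset.sum_le_sum hpt).trans ?_
    rw [Finset.sum_add_distrib, Finset.sum_const, Finset.card_range, nsmul_eq_mul,
      ← Finset.sum_filter, Finset.sum_const, nsmul_eq_mul]
    have hX1 : 0 ≤ (X : ℝ) * (T + 1) := by positivity
    -- `#{j < L : j < T} ≤ ⌈T⌉ ≤ T + 1`
    have hsub : (range L).filter (fun j : ℕ => (j : ℝ) < T) ⊆ range ⌈T⌉₊ := by
      intro j hj
      rw [Finset.mem_filter] at hj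
      exact Finset.mem_range.mpr (Nat.lt_ceil.mpr hj.2)
    have hcard : (#((range L).filter (fun j : ℕ => (j : ℝ) < T)) : ℝ) ≤ T + 1 := by
      calc (#((range L).filter (fun j : ℕ => (j : ℝ) < T)) : ℝ) ≤ #(range ⌈T⌉₊) := by
            exact_mod_cast Finset.card_le_card hsub
        _ = ⌈T⌉₊ := by rw [Finset.card_range]
        _ ≤ T + 1 := (Nat.ceil_lt_add_one hT0).le
    have hmul := mul_le_mul_of_nonneg_right hcard hX1
    linarith
  have hfin := majorArc_numerics (A₁ := I' (L - 1) + I' L) (A₂ := ∑ j ∈ range L, I' j)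
    hW hd1 hdW hq1 hqW hHW hX0 hC₁0 (Nat.cast_nonneg L) hLreal hε0 hε hT hA₁ hA₂
  rw [hC₁] at hfin
  exact hstep2.trans hfin

/-! ### Growth lemmas -/

/-- Eventually `(log X)^K ≤ X`. [folklore] -/
theorem eventually_rpow_log_le_natCast (K : ℝ) : ∀ᶠ X : ℕ in atTop, Real.log X ^ K ≤ X := by
  have h1 : ∀ᶠ X : ℕ in atTop, 2 * |K| + 1 ≤ Real.log X ^ (1 / 2 : ℝ) :=
    ((tendsto_rpow_atTop (by norm_num : (0 : ℝ) < 1 / 2)).comp tendsto_log_natCast).eventually_ge_atTop _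
  filter_upwards [h1, tendsto_log_natCast.eventually_ge_atTop 1, eventually_gt_atTop 0] with X hX hL1 hX0
  have hX0' : (0 : ℝ) < X := by exact_mod_cast hX0
  set u := Real.log (X : ℝ) with hu
  have hu0 : 0 < u := by linarith
  have hlog : Real.log u ≤ u ^ (1 / 2 : ℝ) / (1 / 2) := log_le_rpow_div' hL1 (by norm_num)
  have hlog0 : 0 ≤ Real.log u := Real.log_nonneg hL1
  have hsq : u ^ (1 / 2 : ℝ) * u ^ (1 / 2 : ℝ) = u := by
    rw [← Real.rpow_add hu0]; norm_num
  have hr0 : 0 ≤ u ^ (1 / 2 : ℝ) := Real.rpow_nonneg hu0.le _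
  have hK : Real.log u * K ≤ u := by
    calc Real.log u * K ≤ Real.log u * |K| := mul_le_mul_of_nonneg_left (le_abs_self K) hlog0
      _ ≤ (u ^ (1 / 2 : ℝ) / (1 / 2)) * |K| := mul_le_mul_of_nonneg_right hlog (abs_nonneg K)
      _ = u ^ (1 / 2 : ℝ) * (2 * |K|) := by ring
      _ ≤ u ^ (1 / 2 : ℝ) * u ^ (1 / 2 : ℝ) := mul_le_mul_of_nonneg_left (by linarith) hr0
      _ = u := hsq
  rw [Real.rpow_def_of_pos hu0]
  calc Real.exp (Real.log u * K) ≤ Real.exp u := Real.exp_le_exp.mpr hK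
    _ = X := by rw [hu, Real.exp_log hX0']

/-- From `log H/log log X → ∞`: eventually `(log X)^K ≤ H X`. [folklore] -/
theorem eventually_rpow_log_le_H {H : ℕ → ℕ}
    (hH : Tendsto (fun X : ℕ => Real.log (H X) / Real.log (Real.log X)) atTop atTop) (K : ℝ) :
    ∀ᶠ X : ℕ in atTop, Real.log X ^ K ≤ H X := by
  filter_upwards [tendsto_atTop.1 hH K, eventually_one_le_H hH,
    (Real.tendsto_log_atTop.comp tendsto_log_natCast).eventually_gt_atTop 0,
    tendsto_log_natCast.eventually_gt_atTop 0] with X hK h1 hll hl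
  have hH0 : (0 : ℝ) < H X := by exact_mod_cast h1
  have hK' : K * Real.log (Real.log X) ≤ Real.log (H X) := (le_div_iff₀ hll).mp hK
  rw [Real.rpow_def_of_pos hl, mul_comm]
  calc Real.exp (K * Real.log (Real.log X)) ≤ Real.exp (Real.log (H X)) := Real.exp_le_exp.mpr hK'
    _ = H X := Real.exp_log hH0

end Lichtman2020

/-! ### Proposition 3.2 from Proposition 3.4 -/

open Lichtman2020 ArithmeticFunction in
/-- **Lichtman 2020, Proposition 3.2 (key major arc estimate) from Proposition 3.4** ("Proof of
Proposition 3.2 from Proposition 3.4", pp. 10–11): the named fact `Lichtman2020_liouvilleMeanSquare`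
implies the named fact `Lichtman2020_majorArcEstimate` of `MoebiusShiftedPrimesArcs.lean`.  For
`α ∈ 𝔐`, `α = a/q + θ` with `q ≤ W`, `|θ| ≤ 1/(qQ₁) = W⁴/(qH)`; the integral is the finite sum
`∑_{k ≤ X} |∑_{k ≤ md ≤ k+H-1, m ∈ S} λ(m)e(mα)|` (`integral_window_div_eq_sum`), bounded by
`majorArc_fixed_bound`; its inputs hold eventually: `2 ≤ W`, `W⁶ ≤ H` (`ψ → ∞`), `W⁶ ≤ X`,
`S(cm) ↔ S(m)` for `c ∣ q` (`c ≤ W < P₁, P₂`, "noting `𝟙_{S_d}(cm) = 𝟙_{S_{cd}}(m)` since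
`c ≤ q < P₁`"), and Proposition 3.4 for the moduli `q' = q/c ≤ W`, discretised on integer blocks
`[Y, 2Y]` by `integral_window_eq_sum_Ioc`. [cite: Lichtman2020, Proposition 3.2] -/
theorem Lichtman2020_majorArcEstimate_of_liouvilleMeanSquare
    (h34 : Lichtman2020_liouvilleMeanSquare) : Lichtman2020_majorArcEstimate := by
  intro A hA δ hδ H hH hHexp
  have hA0 : 0 < A := by linarith
  obtain ⟨C, hC⟩ := h34 A hA δ hδ H hH hHexp
  obtain ⟨C', hC'⟩ : ∃ C' : ℝ, C' = max C 0 := ⟨_, rfl⟩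
  have hC'0 : 0 ≤ C' := by rw [hC']; exact le_max_right _ _
  have hCC' : C ≤ C' := by rw [hC']; exact le_max_left _ _
  refine ⟨2 * (6 + 12 * Real.sqrt C') + 2 * Real.pi * (6 + 12 * Real.sqrt C') + 8 * Real.pi, ?_⟩
  -- eventual inequalities
  have hW2 : ∀ᶠ X : ℕ in atTop, 2 ≤ Real.log X ^ A :=
    ((tendsto_rpow_atTop hA0).comp tendsto_log_natCast).eventually_ge_atTop 2
  have hH6 : ∀ᶠ X : ℕ in atTop, Real.log X ^ (6 * A) ≤ H X := eventually_rpow_log_le_H hH (6 * A)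
  have hX6 : ∀ᶠ X : ℕ in atTop, Real.log X ^ (6 * A) ≤ X := eventually_rpow_log_le_natCast (6 * A)
  have hP2 : ∀ᶠ X : ℕ in atTop, Real.log X ^ A < Real.exp (Real.log X ^ (2 / 3 + δ / 2)) := by
    filter_upwards [eventually_sqrtW_lt_P2 (2 * A) δ hδ] with X hX
    rwa [show 2 * A / 2 = A by ring] at hX
  have hlog1 : ∀ᶠ X : ℕ in atTop, 1 < Real.log X := tendsto_log_natCast.eventually_gt_atTop 1
  filter_upwards [hC, hW2, hH6, hX6, hP2, hlog1, eventually_ge_atTop 1] with X hCX hW2X hH6X hX6X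
    hP2X hlog1X hX1 d hd hdW α hα
  have hL0 : 0 < Real.log X := by linarith
  -- powers of `W = (log X)^A`
  have hpow : ∀ n : ℕ, Real.log X ^ ((n : ℝ) * A) = (Real.log X ^ A) ^ n := fun n => by
    rw [mul_comm, Real.rpow_mul hL0.le, Real.rpow_natCast]
  have h4 : Real.log X ^ (4 * A) = (Real.log X ^ A) ^ 4 := by exact_mod_cast hpow 4
  have h5 : Real.log X ^ (5 * A) = (Real.log X ^ A) ^ 5 := by exact_mod_cast hpow 5
  have h6 : Real.log X ^ (6 * A) = (Real.log X ^ A) ^ 6 := by exact_mod_cast hpow 6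
  have h10 : Real.log X ^ (10 * A) = (Real.log X ^ A) ^ 10 := by exact_mod_cast hpow 10
  rw [h6] at hH6X hX6X
  set W : ℝ := Real.log X ^ A with hWdef
  have hW0 : 0 < W := by linarith
  have hHX0 : (0 : ℝ) < H X := lt_of_lt_of_le (by positivity) hH6X
  -- the major arc datum `α = a/q + θ`
  simp only [lichtmanMajorArcs, lichtmanMajorArc, Set.mem_iUnion, Set.mem_setOf_eq] at hα
  obtain ⟨q, ⟨hq1, hqW⟩, a, -, hθ'⟩ := hα
  have hq0 : (0 : ℝ) < q := by exact_mod_cast hq1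
  obtain ⟨θ, hθdef⟩ : ∃ θ : ℝ, θ = α - a / q := ⟨_, rfl⟩
  have hαθ : (a : ℝ) / q + θ = α := by rw [hθdef]; ring
  have hθ : |θ| ≤ W ^ 4 / (q * H X) := by
    rw [h4] at hθ'
    rw [hθdef]
    calc |α - a / q| ≤ 1 / (q * (H X / W ^ 4)) := hθ'
      _ = W ^ 4 / (q * H X) := by field_simp
  -- the integral is a finite sum over `k ≤ X`
  rw [integral_window_div_eq_sum
    (fun s => ‖liouvilleTwistedSum (s.filter (lichtmanTypical X A δ (H X))) α‖) X (H X) d hd]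
  -- `S(cm) ↔ S(m)` for `c ∣ q`
  have hS : ∀ c ∈ q.divisors, ∀ m,
      lichtmanTypical X A δ (H X) (c * m) ↔ lichtmanTypical X A δ (H X) m := by
    intro c hc m
    have hc0 : c ≠ 0 := (Nat.pos_of_mem_divisors hc).ne'
    have hcW : (c : ℝ) ≤ W := le_trans (by exact_mod_cast Nat.divisor_le hc) hqW
    have hp : ∀ p ∈ c.primeFactors, (p : ℝ) ≤ W := fun p hp =>
      le_trans (by exact_mod_cast Nat.le_of_mem_primeFactors hp) hcW
    have hWP1 : W < Real.log X ^ (33 * A) :=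
      Real.rpow_lt_rpow_of_exponent_lt hlog1X (by linarith)
    unfold lichtmanTypical
    rw [hasPrimeFactorIn_mul_iff hc0 (fun p hp' => (hp p hp').trans_lt hWP1),
      hasPrimeFactorIn_mul_iff hc0 (fun p hp' => (hp p hp').trans_lt hP2X)]
  -- Proposition 3.4 for the moduli `q/c`, discretised
  have h34d : ∀ c ∈ q.divisors, ∀ χ : DirichletCharacter ℂ (q / c), ∀ h : ℕ,
      (H X : ℝ) / W ^ 5 ≤ h → h ≤ H X → ∀ Y : ℕ, (X : ℝ) / W ^ 6 ≤ Y → Y ≤ X →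
        ∑ k ∈ Ioc Y (2 * Y), ‖∑ m ∈ (Icc k (k + h - 1)).filter (lichtmanTypical X A δ (H X)),
            χ (m : ZMod (q / c)) * ((liouville m : ℤ) : ℂ)‖ ^ 2 ≤
          C' * ((h : ℝ) ^ 2 * Y / W ^ 10) := by
    intro c hc χ h hh1 hh2 Y hY1 hY2
    have hc0 : 0 < c := Nat.pos_of_mem_divisors hc
    have hcq : c ∣ q := Nat.dvd_of_mem_divisors hc
    have hq'1 : 1 ≤ q / c := Nat.div_pos (Nat.le_of_dvd hq1 hcq) hc0
    have hq'W : ((q / c : ℕ) : ℝ) ≤ W := le_trans (by exact_mod_cast Nat.div_le_self q c) hqW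
    have hh1' : (H X : ℝ) / Real.log X ^ (5 * A) ≤ h := by rwa [h5]
    have hY1' : (X : ℝ) / Real.log X ^ (6 * A) ≤ (Y : ℝ) := by rwa [h6]
    have hY2' : ((Y : ℕ) : ℝ) ≤ X := by exact_mod_cast hY2
    have hint := hCX (q / c) hq'1 hq'W χ h hh1' hh2 Y hY1' hY2'
    rw [h10] at hint
    have hh0 : 1 ≤ h := by
      have e1 : W ≤ (H X : ℝ) / W ^ 5 := by
        rw [le_div_iff₀ (by positivity)]
        calc W * W ^ 5 = W ^ 6 := by ring
          _ ≤ (H X : ℝ) := hH6X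
      have : (1 : ℝ) ≤ h := by linarith
      exact_mod_cast this
    have hdisc := integral_window_eq_sum_Ioc (fun s => ‖∑ m ∈ s.filter (lichtmanTypical X A δ (H X)),
        ((liouville m : ℤ) : ℂ) * χ (m : ZMod (q / c))‖ ^ 2) Y (2 * Y) h (by omega) hh0
    have hcast : ((2 * Y : ℕ) : ℝ) = 2 * (Y : ℝ) := by push_cast; ring
    rw [hcast] at hdisc
    rw [hdisc] at hint
    have hcomm : ∀ s : Finset ℕ, ∑ m ∈ s, χ (m : ZMod (q / c)) * ((liouville m : ℤ) : ℂ) =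
        ∑ m ∈ s, ((liouville m : ℤ) : ℂ) * χ (m : ZMod (q / c)) :=
      fun s => Finset.sum_congr rfl fun m _ => mul_comm _ _
    simp only [hcomm]
    exact hint.trans (mul_le_mul_of_nonneg_right hCC' (by positivity))
  -- the bound at the fixed scale `X`
  have hcore := majorArc_fixed_bound (X := X) (H := H X) (d := d) (q := q) (a := a) (θ := θ)
    (W := W) (C := C') (lichtmanTypical X A δ (H X)) hX1 hd hdW hq1 hqW hW2X hH6X hX6X hθ hC'0
    hS h34d
  rw [hαθ] at hcore
  simp only [liouvilleTwistedSum]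
  exact hcore

open Lichtman2020 in
/-- **Theorem 2.2 from Propositions 3.1 and 3.4** — the state of the decomposition after this
file: Prop 3.4 ⟹ Prop 3.2 (here), Prop 3.1 + Prop 3.2 ⟹ Prop 2.3 (regime) ⟹ Thm 2.2
(`MoebiusShiftedPrimesArcs.lean`). [cite: Lichtman2020, Theorem 2.2] -/
theorem Lichtman2020_keyFourierEstimate_of_minorArc_of_liouvilleMeanSquare
    (h31 : Lichtman2020_minorArcEstimate) (h34 : Lichtman2020_liouvilleMeanSquare) :
    Lichtman2020_keyFourierEstimate :=
  Lichtman2020_keyFourierEstimate_of_liouville'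
    (Lichtman2020_keyFourierEstimateLiouville'_of_arcs h31
      (Lichtman2020_majorArcEstimate_of_liouvilleMeanSquare h34))

open Lichtman2020 in
/-- **Lichtman's Theorem 1.1 (qualitative part) from Propositions 3.1 and 3.4**, the sieve bound
(2.5) being the proved `Lichtman2020_shiftedPrimeSieveBound_holds`. [cite: Lichtman2020, Theorem 1.1] -/
theorem lichtman2020_moebius_shifted_primes_avg_of_minorArc_of_liouvilleMeanSquare
    (h31 : Lichtman2020_minorArcEstimate) (h34 : Lichtman2020_liouvilleMeanSquare) :
    lichtman2020_moebius_shifted_primes_avg :=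
  lichtman2020_moebius_shifted_primes_avg_of_keyFourierEstimate'
    (Lichtman2020_keyFourierEstimate_of_minorArc_of_liouvilleMeanSquare h31 h34)

open Lichtman2020 in
/-- **Lichtman's Theorem 1.1 (power range `H = X^θ`) from Propositions 3.1 and 3.4**, through
`lichtman2020_moebius_shifted_primes_avg_power_of_keyFourierEstimate`
(`MoebiusShiftedPrimesDecomposition.lean`). [cite: Lichtman2020, Theorem 1.1] -/
theorem lichtman2020_moebius_shifted_primes_avg_power_of_minorArc_of_liouvilleMeanSquare
    (h31 : Lichtman2020_minorArcEstimate) (h34 : Lichtman2020_liouvilleMeanSquare) :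
    lichtman2020_moebius_shifted_primes_avg_power :=
  lichtman2020_moebius_shifted_primes_avg_power_of_keyFourierEstimate
    (Lichtman2020_keyFourierEstimate_of_minorArc_of_liouvilleMeanSquare h31 h34)

end Literature.NumberTheory.Sieve
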